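import Literature.MathematicalPhysics.QuantumFieldTheory.Balaban1983to89.B1Ineq234LevelZero

/-!
# `Balaban1983to89.B3Op116ScaleChains` — T. Bałaban, *(Higgs)₂,₃ quantum fields in a finite volume. III. Renormalization*,
# Commun. Math. Phys. **88** (1983) 411–445 [Balaban1983Higgs3], (1.16) p. 414 / (2.5), (2.6), (2.10) pp. 424–426:
# **THE MULTI-SCALE LATTICE-SUM ENGINE behind «for n, n′ sufficiently large, a kernel of the operator (1.16) is a sufficiently
# regular function of both variables»** — growth of the uniform torus-sum constant, convolutions of exponential kernels living on
# different scales `L^jε` of the decomposition (2.6), top-dominated geometric scale sums, and the `ℓ²`-COLUMN LEMMA for a kernel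
# obeying the (2.10) profile at every scale piece (the outer factors of the chains of (1.16))

statement-level skeleton of published theorems with citation tags; proofs where landed; nothing here is a claim about the Yang–Mills mass gap

PDF held: `paper:balaban1983-higgs-2-3-quantum-fields-finite-volume` p. 414 [PDF 4] ((1.16) and the two sentences quoted below), pp. 424, 426
[PDF 14, 16] ((2.5), (2.6), (2.10)); [Balaban1983RegularityDecay] = `paper:balaban1983-cmp89-regularity-decay` Sect. 5 p. 594 (lattice sums).

CITATION HEADER (lean-in-tree rule).  T. Bałaban, CMP **88** (1983) 411–445 [Balaban1983Higgs3]: (1.16) p. 414, (2.5) p. 424, (2.6) p. 424,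
(2.10) p. 426; T. Bałaban, *Regularity and decay of lattice Green's functions*, CMP **89** (1983) 571–597 [Balaban1983RegularityDecay], Sect. 5
Theorem p. 594 (uniform lattice sums).  Cell `lit-balaban` (HOME `run/shared/lean/pub/lit-balaban/`), reader/typer seat **r14** gen 19 (unit
`lit-balaban-r14`, literature-prover-lit-balaban-r14-g19-0; TAKING HOME/STATUS.md 2026-08-23T00:45:37Z «the ANALYTIC HALF of (1.16)», owner
r15 no objection 00:48:57Z; design `lit-balaban-r14/DESIGN-B3-116-analytic.md`); SKELETON rows **B3.Eq1.16** / **B3.Eq2.5** (owner r15) —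
LOCATED ENGINE FILE (no head claim): the lattice-sum lemmas every kernel bound of the operator (1.16) runs on.  USED BY NAME, never restated:
`B1Ineq234Concrete.{rho, rho_sumBound, rho_eq_tdist, profile, nCol}` (the uniform torus sums of [Balaban1983RegularityDecay] Sect. 5 on the
model's tori), `B4Sect5Proof.latticeConst`, `B1Ineq234LevelZero.{tdist_comm, tdist_triangle_real, tdist_shift_le_one}`, typer's `HiggsLattice`.

WHAT IS PRINTED (verbatim, p. 414 [PDF 4]): *"Perhaps the simplest way is to treat it as an external field, because for n, n′ sufficiently large,
a kernel of the operator (1.16) is a sufficiently regular function of both variables. More exactly the Hölder norms of the covariant derivatives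
of this kernel, the norms defined for example in the inequalities (I.2.24) and (I.2.25) of Proposition I.2.1, are exponentially decaying with
the distance of the arguments and are uniformly bounded by O(1)(e(L^kε)^{1−α})^{n+n′}, where α > 0 but can be arbitrarily small. This estimate
follows easily from the properties of the propagators G_k(Ω, A) proved in the next paper."*  (2.6) p. 424: *"G_k(Ω,B̃) = Σ_{j=0}^{k−1} G^η_{(j)}(Ω,B̃)"*;
(2.10) p. 426: *"|G^η_{(j)}(Ω,B̃;x,x′)| ≤ O(1)(L^jη)^{−d+2}e^{−δ₁(L^jη)^{−1}|x−x′|}, and if the propagator is differentiated, then for each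
differentiation, there is an additional factor (L^jη)^{−1} on the right side."*

WHY THIS FILE (the mechanism, `DESIGN-B3-116-analytic.md` §2).  The operator (1.16) expands (by the six-term bracket of (I.3.44)) into CHAINS of
propagator factors, each a sum over the scale pieces (2.6) with the kernel profile (2.10); a kernel of a chain is a lattice convolution of
exponentials `e^{−δ|x−y|/(L^{j_i}ε)}` living on DIFFERENT scales, and the scale sums that follow are geometric and dominated by the top scale
`L^kε` exactly when the powers of `L^jε` collected along the chain are positive — this is the arithmetic behind «for n, n′ sufficiently large».
The lemmas here are that arithmetic, on the model's tori (every `HiggsLattice.Params`, uniform in the volume):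
* §1 `latticeConst_le_pow`: the uniform sum constant of [Balaban1983RegularityDecay] Sect. 5, `K_d(a) = (2(1 − e^{−a/d})⁻¹)^d`, grows like
  `(4d/a)^d` as the rate `a ↓ 0` (so a sum `Σ_y e^{−δL^{−j}|x−y|}` over `T_ε` costs the VOLUME `(L^j)^d` of the scale, `sum_exp_scale_le`);
  `latticeConst_antitone`.
* §2 `conv2_le` / `conv3_le`: two- and three-kernel convolutions `Σ_s e^{−a|u−s|}e^{−b|s−v|} ≤ K(max/2)·e^{−(min/2)|u−v|}` (volume of the FINER
  scale, decay at the COARSER rate, rates halving), over the coordinate indices `T_ε × {1,…,N}` as the matrix entries of the chains require;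
  `exp_tdist_shift_le` (a one-bond shift of a site costs a factor `e^{a}` — the local multipliers of the bracket move sites by one bond).
* §3 `sum_mesh_rpow_le` / `sum2_mesh_rpow_le`: `Σ_{j<k}(L^jε)^s ≤ (L^kε)^s/(L^s − 1)` for `s > 0`, and the nested two-scale sum
  `Σ_{j₁≤j₂<k}(L^{j₁}ε)^a(L^{j₂}ε)^b ≤ C·(L^kε)^{a+b}` for `a > 0`, `a + b > 0`.
* §4 **`sq_col_le`**, the `ℓ²`-COLUMN LEMMA: if a family of columns obeys the (2.10) value profile, `|K_j(y)| ≤ c(L^jε)^{2−d}e^{−δ(L^jε)^{−1}ε|y−x|}`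
  for `j < k`, then `Σ_y ε^d(Σ_{j<k}|K_j(y)|)² ≤ c²·N·(2d/δ)^d·(L^{(4−d)/2} − 1)^{−2}·(L^kε)^{4−d}` provided `d ≤ 3` — the outer propagator factors
  of the chains have square-summable kernel columns, uniformly in `k` and in the volume (Cauchy–Schwarz with the geometric weights
  `(L^jε/L^kε)^{(4−d)/2}`, §1 for each scale, §3 for the scale sum).
HONEST SCOPE.  Pure lattice-sum lemmas (no propagator, no field); nothing of (1.16) itself is asserted here — the kernel bounds of the operator
(1.16) at a regular background are the business of the sibling files `B3Op116Pieces` (seat p40: the bracket of (I.3.44) on the carrier) and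
`B3Op116KernelRegularTorus` (r14: the chains).  No `def … : Prop`, no `sorry`; axioms standard.
-/

noncomputable section

open scoped BigOperators

namespace Literature.MathematicalPhysics.QuantumFieldTheory.Balaban1983to89.B3Op116ScaleChains

open B1Eq230FluctCov (Ix)
open B1Ineq234Concrete (rho rho_sumBound rho_eq_tdist profile profile_nonneg' nCol nCol_eq)
open B1Ineq234LevelZero (tdist_comm tdist_triangle_real tdist_shift_le_one)
open B4Sect5Proof (latticeConst latticeConst_nonneg)

variable {P : HiggsLattice.Params} {N : ℕ}

/-! ## §1 Growth of the uniform lattice-sum constant as the rate goes to zero -/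

section Growth

/-- **Growth of `K_d(a) = (2(1 − e^{−a/d})⁻¹)^d`**: `K_d(a) ≤ (4d/a)^d` for `0 < a ≤ 1/2` (`d ≥ 1`) — a torus sum `Σ_y e^{−a|x−y|}` costs the
volume `a^{−d}`. [cite: Balaban1983RegularityDecay, Sect. 5 Theorem p.594] -/
theorem latticeConst_le_pow {d : ℕ} (hd : 1 ≤ d) {a : ℝ} (ha : 0 < a) (ha2 : a ≤ 1 / 2) :
    latticeConst d a ≤ (4 * d / a) ^ d := by
  have hd0 : (0 : ℝ) < d := by exact_mod_cast hd
  have hu0 : 0 ≤ a / d := div_nonneg ha.le hd0.le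
  have hu : a / d ≤ 1 / 2 := by
    rw [div_le_iff₀ hd0]
    have : (1 : ℝ) ≤ d := by exact_mod_cast hd
    nlinarith
  -- `1 − e^{−u} ≥ u/2` for `0 ≤ u ≤ 1/2`, from `|e^x − 1 − x| ≤ x²` (`|x| ≤ 1`)
  have hlow : a / d / 2 ≤ 1 - Real.exp (-(a / d)) := by
    have h := Real.abs_exp_sub_one_sub_id_le (x := -(a / d)) (by rw [abs_neg, abs_of_nonneg hu0]; linarith)
    have h1 : Real.exp (-(a / d)) - 1 - (-(a / d)) ≤ (-(a / d)) ^ 2 := le_of_abs_le h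
    have h2 : (a / d) ^ 2 ≤ (a / d) / 2 := by nlinarith
    nlinarith
  have hpos : 0 < a / d / 2 := by positivity
  have hinv : (1 - Real.exp (-(a / d)))⁻¹ ≤ (a / d / 2)⁻¹ := inv_anti₀ hpos hlow
  have h2 : 2 * (1 - Real.exp (-(a / d)))⁻¹ ≤ 4 * d / a := by
    calc 2 * (1 - Real.exp (-(a / d)))⁻¹ ≤ 2 * (a / d / 2)⁻¹ := by
          exact mul_le_mul_of_nonneg_left hinv (by norm_num)
      _ = 4 * d / a := by field_simp; ring
  have h0 : 0 ≤ 2 * (1 - Real.exp (-(a / d)))⁻¹ :=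
    mul_nonneg (by norm_num) (inv_nonneg.mpr (le_trans hpos.le hlow))
  unfold latticeConst
  exact pow_le_pow_left₀ h0 h2 d

/-- `K_d` is antitone in the rate: `a ≤ b ⇒ K_d(b) ≤ K_d(a)` (`a > 0`). [cite: Balaban1983RegularityDecay, Sect. 5 Theorem p.594] -/
theorem latticeConst_antitone {d : ℕ} {a b : ℝ} (ha : 0 < a) (hab : a ≤ b) : latticeConst d b ≤ latticeConst d a := by
  unfold latticeConst
  have hd : (0 : ℝ) ≤ d := Nat.cast_nonneg d
  have hea : Real.exp (-(b / d)) ≤ Real.exp (-(a / d)) :=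
    Real.exp_le_exp.mpr (neg_le_neg (div_le_div_of_nonneg_right hab hd))
  have hpa : 0 < 1 - Real.exp (-(a / d)) ∨ 1 - Real.exp (-(a / d)) = 0 := by
    rcases (Nat.eq_zero_or_pos d) with h0 | hdp
    · right; subst h0; simp
    · left
      have : Real.exp (-(a / d)) < 1 := Real.exp_lt_one_iff.mpr (by
        have : 0 < a / d := div_pos ha (by exact_mod_cast hdp); linarith)
      linarith
  rcases hpa with hpa | hza
  · have hinv : (1 - Real.exp (-(b / d)))⁻¹ ≤ (1 - Real.exp (-(a / d)))⁻¹ := inv_anti₀ hpa (by linarith)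
    exact pow_le_pow_left₀ (mul_nonneg (by norm_num) (inv_nonneg.mpr (by linarith))) (mul_le_mul_of_nonneg_left hinv (by norm_num)) d
  · -- degenerate `d = 0`: both sides are `1`
    have hzb : 1 - Real.exp (-(b / d)) = 0 := by
      have h1 : Real.exp (-(a / d)) = 1 := by linarith
      have : -(a / d) = 0 := by simpa using Real.exp_eq_one_iff (-(a/d)) |>.mp h1
      have hd0 : (d : ℝ) = 0 := by
        by_contra hne
        have : a / d ≠ 0 := div_ne_zero ha.ne' hne
        exact this (by linarith)
      simp [hd0]
    rw [hza, hzb]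

/-- The model's profile `N·K_d(a)` inherits the growth bound: `profile P N a ≤ N·(4d/a)^d` for `0 < a ≤ 1/2`.
[cite: Balaban1983RegularityDecay, Sect. 5 Theorem p.594] -/
theorem profile_le_pow {a : ℝ} (ha : 0 < a) (ha2 : a ≤ 1 / 2) :
    profile P N a ≤ (nCol N : ℝ) * (4 * P.d / a) ^ P.d :=
  mul_le_mul_of_nonneg_left (latticeConst_le_pow P.hd ha ha2) (Nat.cast_nonneg _)

/-- The profile is antitone in the rate. [cite: Balaban1983RegularityDecay, Sect. 5 Theorem p.594] -/
theorem profile_antitone {a b : ℝ} (ha : 0 < a) (hab : a ≤ b) : profile P N b ≤ profile P N a :=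
  mul_le_mul_of_nonneg_left (latticeConst_antitone ha hab) (Nat.cast_nonneg _)

/-- **A torus sum over the coordinate indices at rate `a`**: `Σ_q e^{−a|u − y_q|} ≤ profile(a)` (the uniform bound of [Balaban1983RegularityDecay]
Sect. 5 on every torus of the model, `B1Ineq234Concrete.rho_sumBound`, written with the distance (I.1.3)). [cite: Balaban1983RegularityDecay, Sect. 5 Theorem p.594] -/
theorem sum_exp_tdist_le {k : ℕ} {a : ℝ} (ha : 0 < a) (u : HiggsLattice.Site P k) (i₀ : Ix N) :
    ∑ q : HiggsLattice.Site P k × Ix N, Real.exp (-(a * (HiggsLattice.Site.tdist u q.1 : ℝ))) ≤ profile P N a := by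
  have h := rho_sumBound (P := P) (N := N) (k := k) a ha (u, i₀)
  simp_rw [rho_eq_tdist] at h
  exact h

/-- **The sum at scale `L^j`**: `Σ_q e^{−(δ/L^j)|u − y_q|} ≤ N·(4d/δ)^d·L^{jd}` for `0 < δ ≤ 1/2` — the volume of the `j`-th scale in
`ε`-units. [cite: Balaban1983Higgs3, (2.10) p.426] [cite: Balaban1983RegularityDecay, Sect. 5 Theorem p.594] -/
theorem sum_exp_scale_le {k : ℕ} {δ : ℝ} (hδ : 0 < δ) (hδ2 : δ ≤ 1 / 2) (j : ℕ) (u : HiggsLattice.Site P k) (i₀ : Ix N) :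
    ∑ q : HiggsLattice.Site P k × Ix N, Real.exp (-(δ / (P.L : ℝ) ^ j * (HiggsLattice.Site.tdist u q.1 : ℝ)))
      ≤ (nCol N : ℝ) * (4 * P.d / δ) ^ P.d * ((P.L : ℝ) ^ j) ^ P.d := by
  have hL : (1 : ℝ) ≤ (P.L : ℝ) ^ j := one_le_pow₀ (by exact_mod_cast P.hL)
  have hLpos : (0 : ℝ) < (P.L : ℝ) ^ j := by positivity
  have ha : 0 < δ / (P.L : ℝ) ^ j := div_pos hδ hLpos
  have ha2 : δ / (P.L : ℝ) ^ j ≤ 1 / 2 := (div_le_self hδ.le hL).trans hδ2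
  refine (sum_exp_tdist_le ha u i₀).trans ((profile_le_pow ha ha2).trans (le_of_eq ?_))
  rw [mul_assoc]
  congr 1
  rw [← mul_pow]
  congr 1
  field_simp

end Growth

/-! ## §2 Convolutions of exponential kernels on two scales -/

section Convolution

variable {k : ℕ}

/-- Splitting the rates with the triangle inequality: for `a ≥ b`,
`e^{−a|u−s|}e^{−b|s−v|} ≤ e^{−(b/2)|u−v|}·e^{−(a/2)|u−s|}`. [cite: Balaban1983Higgs3, (2.10) p.426] -/
theorem exp_mul_exp_le_split {a b : ℝ} (hb : 0 ≤ b) (hab : b ≤ a) (u s v : HiggsLattice.Site P k) :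
    Real.exp (-(a * (HiggsLattice.Site.tdist u s : ℝ))) * Real.exp (-(b * (HiggsLattice.Site.tdist s v : ℝ)))
      ≤ Real.exp (-(b / 2 * (HiggsLattice.Site.tdist u v : ℝ))) * Real.exp (-(a / 2 * (HiggsLattice.Site.tdist u s : ℝ))) := by
  rw [← Real.exp_add, ← Real.exp_add]
  apply Real.exp_le_exp.mpr
  have h1 := tdist_triangle_real u s v
  have h0 : (0 : ℝ) ≤ (HiggsLattice.Site.tdist s v : ℝ) := Nat.cast_nonneg _
  have ha : (0 : ℝ) ≤ (HiggsLattice.Site.tdist u s : ℝ) := Nat.cast_nonneg _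
  nlinarith

/-- **Two kernels on two scales** (`a ≥ b > 0`: the first kernel lives on the FINER scale): `Σ_s e^{−a|u−s|}e^{−b|s−v|} ≤ K(a/2)·e^{−(b/2)|u−v|}`
— the volume of the finer scale, the decay of the coarser one. [cite: Balaban1983Higgs3, (2.10) p.426] [cite: Balaban1983RegularityDecay, Sect. 5 Theorem p.594] -/
theorem conv2_le {a b : ℝ} (hb : 0 < b) (hab : b ≤ a) (u v : HiggsLattice.Site P k) (i₀ : Ix N) :
    ∑ s : HiggsLattice.Site P k × Ix N,
        Real.exp (-(a * (HiggsLattice.Site.tdist u s.1 : ℝ))) * Real.exp (-(b * (HiggsLattice.Site.tdist s.1 v : ℝ)))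
      ≤ profile P N (a / 2) * Real.exp (-(b / 2 * (HiggsLattice.Site.tdist u v : ℝ))) := by
  have ha2 : 0 < a / 2 := by linarith
  calc ∑ s : HiggsLattice.Site P k × Ix N,
        Real.exp (-(a * (HiggsLattice.Site.tdist u s.1 : ℝ))) * Real.exp (-(b * (HiggsLattice.Site.tdist s.1 v : ℝ)))
      ≤ ∑ s : HiggsLattice.Site P k × Ix N,
          Real.exp (-(b / 2 * (HiggsLattice.Site.tdist u v : ℝ))) * Real.exp (-(a / 2 * (HiggsLattice.Site.tdist u s.1 : ℝ))) :=
        Finset.sum_le_sum fun s _ => exp_mul_exp_le_split hb.le hab u s.1 v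
    _ = Real.exp (-(b / 2 * (HiggsLattice.Site.tdist u v : ℝ))) *
          ∑ s : HiggsLattice.Site P k × Ix N, Real.exp (-(a / 2 * (HiggsLattice.Site.tdist u s.1 : ℝ))) := by
        rw [Finset.mul_sum]
    _ ≤ Real.exp (-(b / 2 * (HiggsLattice.Site.tdist u v : ℝ))) * profile P N (a / 2) :=
        mul_le_mul_of_nonneg_left (sum_exp_tdist_le ha2 u i₀) (Real.exp_pos _).le
    _ = _ := mul_comm _ _

/-- The same with the kernels in the other order (`b ≥ a > 0`: the SECOND kernel is the finer one):
`Σ_s e^{−a|u−s|}e^{−b|s−v|} ≤ K(b/2)·e^{−(a/2)|u−v|}`. [cite: Balaban1983Higgs3, (2.10) p.426] [cite: Balaban1983RegularityDecay, Sect. 5 Theorem p.594] -/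
theorem conv2_le' {a b : ℝ} (ha : 0 < a) (hab : a ≤ b) (u v : HiggsLattice.Site P k) (i₀ : Ix N) :
    ∑ s : HiggsLattice.Site P k × Ix N,
        Real.exp (-(a * (HiggsLattice.Site.tdist u s.1 : ℝ))) * Real.exp (-(b * (HiggsLattice.Site.tdist s.1 v : ℝ)))
      ≤ profile P N (b / 2) * Real.exp (-(a / 2 * (HiggsLattice.Site.tdist u v : ℝ))) := by
  have h := conv2_le (P := P) (N := N) ha hab v u i₀
  rw [tdist_comm v u] at h
  refine le_trans (le_of_eq (Finset.sum_congr rfl fun s _ => ?_)) h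
  rw [tdist_comm u s.1, tdist_comm s.1 v, mul_comm]

/-- **Two kernels, either order**: `Σ_s e^{−a|u−s|}e^{−b|s−v|} ≤ K(max(a,b)/2)·e^{−(min(a,b)/2)|u−v|}`.
[cite: Balaban1983Higgs3, (2.10) p.426] [cite: Balaban1983RegularityDecay, Sect. 5 Theorem p.594] -/
theorem conv2_le_max {a b : ℝ} (ha : 0 < a) (hb : 0 < b) (u v : HiggsLattice.Site P k) (i₀ : Ix N) :
    ∑ s : HiggsLattice.Site P k × Ix N,
        Real.exp (-(a * (HiggsLattice.Site.tdist u s.1 : ℝ))) * Real.exp (-(b * (HiggsLattice.Site.tdist s.1 v : ℝ)))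
      ≤ profile P N (max a b / 2) * Real.exp (-(min a b / 2 * (HiggsLattice.Site.tdist u v : ℝ))) := by
  rcases le_total b a with hba | hab
  · rw [max_eq_left hba, min_eq_right hba]; exact conv2_le hb hba u v i₀
  · rw [max_eq_right hab, min_eq_left hab]; exact conv2_le' ha hab u v i₀

/-- **Three kernels**: `Σ_{s,t} e^{−a|u−s|}e^{−b|s−t|}e^{−c|t−v|} ≤ K(max(b,c)/2)·K(max(a, min(b,c)/2)/2)·e^{−(min(a, min(b,c)/2)/2)|u−v|}`
(convolve the last two, then the first with the result). [cite: Balaban1983Higgs3, (2.10) p.426] [cite: Balaban1983RegularityDecay, Sect. 5 Theorem p.594] -/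
theorem conv3_le {a b c : ℝ} (ha : 0 < a) (hb : 0 < b) (hc : 0 < c) (u v : HiggsLattice.Site P k) (i₀ : Ix N) :
    ∑ s : HiggsLattice.Site P k × Ix N, ∑ t : HiggsLattice.Site P k × Ix N,
        Real.exp (-(a * (HiggsLattice.Site.tdist u s.1 : ℝ))) * Real.exp (-(b * (HiggsLattice.Site.tdist s.1 t.1 : ℝ))) *
          Real.exp (-(c * (HiggsLattice.Site.tdist t.1 v : ℝ)))
      ≤ profile P N (max b c / 2) * profile P N (max a (min b c / 2) / 2) *
          Real.exp (-(min a (min b c / 2) / 2 * (HiggsLattice.Site.tdist u v : ℝ))) := by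
  have hbc : 0 < min b c / 2 := by have := lt_min hb hc; linarith
  have hK : 0 ≤ profile P N (max b c / 2) := profile_nonneg' _ (by have := le_max_left b c; linarith)
  calc ∑ s : HiggsLattice.Site P k × Ix N, ∑ t : HiggsLattice.Site P k × Ix N,
        Real.exp (-(a * (HiggsLattice.Site.tdist u s.1 : ℝ))) * Real.exp (-(b * (HiggsLattice.Site.tdist s.1 t.1 : ℝ))) *
          Real.exp (-(c * (HiggsLattice.Site.tdist t.1 v : ℝ)))
      = ∑ s : HiggsLattice.Site P k × Ix N, Real.exp (-(a * (HiggsLattice.Site.tdist u s.1 : ℝ))) *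
          ∑ t : HiggsLattice.Site P k × Ix N,
            Real.exp (-(b * (HiggsLattice.Site.tdist s.1 t.1 : ℝ))) * Real.exp (-(c * (HiggsLattice.Site.tdist t.1 v : ℝ))) := by
        refine Finset.sum_congr rfl fun s _ => ?_
        rw [Finset.mul_sum]
        exact Finset.sum_congr rfl fun t _ => by ring
    _ ≤ ∑ s : HiggsLattice.Site P k × Ix N, Real.exp (-(a * (HiggsLattice.Site.tdist u s.1 : ℝ))) *
          (profile P N (max b c / 2) * Real.exp (-(min b c / 2 * (HiggsLattice.Site.tdist s.1 v : ℝ)))) :=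
        Finset.sum_le_sum fun s _ => mul_le_mul_of_nonneg_left (conv2_le_max hb hc s.1 v i₀) (Real.exp_pos _).le
    _ = profile P N (max b c / 2) * ∑ s : HiggsLattice.Site P k × Ix N,
          Real.exp (-(a * (HiggsLattice.Site.tdist u s.1 : ℝ))) * Real.exp (-(min b c / 2 * (HiggsLattice.Site.tdist s.1 v : ℝ))) := by
        rw [Finset.mul_sum]
        exact Finset.sum_congr rfl fun s _ => by ring
    _ ≤ profile P N (max b c / 2) * (profile P N (max a (min b c / 2) / 2) *
          Real.exp (-(min a (min b c / 2) / 2 * (HiggsLattice.Site.tdist u v : ℝ)))) :=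
        mul_le_mul_of_nonneg_left (conv2_le_max ha hbc u v i₀) hK
    _ = _ := by ring

/-- **A one-bond shift of a site costs a factor `e^{a}`**: `e^{−a|x+e_μ − y|} ≤ e^{a}·e^{−a|x − y|}` (the local multipliers of the bracket of
(I.3.44) move a site by one bond). [cite: Balaban1983Higgs3, (1.16) p.414] [cite: Balaban1982Higgs1, (1.3) p.604] -/
theorem exp_tdist_shift_le {a : ℝ} (ha : 0 ≤ a) (x y : HiggsLattice.Site P k) (μ : Fin P.d) :
    Real.exp (-(a * (HiggsLattice.Site.tdist (x.shift μ) y : ℝ))) ≤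
      Real.exp a * Real.exp (-(a * (HiggsLattice.Site.tdist x y : ℝ))) := by
  rw [← Real.exp_add]
  apply Real.exp_le_exp.mpr
  have h1 := tdist_triangle_real x (x.shift μ) y
  have h2 : (HiggsLattice.Site.tdist x (x.shift μ) : ℝ) ≤ 1 := by exact_mod_cast tdist_shift_le_one x μ
  nlinarith

/-- The same with the shift in the second variable. [cite: Balaban1983Higgs3, (1.16) p.414] [cite: Balaban1982Higgs1, (1.3) p.604] -/
theorem exp_tdist_shift_le' {a : ℝ} (ha : 0 ≤ a) (x y : HiggsLattice.Site P k) (μ : Fin P.d) :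
    Real.exp (-(a * (HiggsLattice.Site.tdist x (y.shift μ) : ℝ))) ≤
      Real.exp a * Real.exp (-(a * (HiggsLattice.Site.tdist x y : ℝ))) := by
  rw [tdist_comm x (y.shift μ), tdist_comm x y]
  exact exp_tdist_shift_le ha y x μ

end Convolution

/-! ## §3 Geometric scale sums, dominated by the top scale -/

section ScaleSums

/-- `L^{j+1}ε = L·L^jε`. [cite: Balaban1982Higgs1, (1.19) p.607] -/
theorem mesh_succ (P : HiggsLattice.Params) (j : ℕ) : P.mesh (j + 1) = (P.L : ℝ) * P.mesh j := by
  simp [HiggsLattice.Params.mesh, pow_succ]; ring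

/-- `(L^jε)^s = (L^s)^j·ε^s` for a real exponent `s`. [cite: Balaban1983Higgs3, (2.10) p.426] -/
theorem mesh_rpow_eq (P : HiggsLattice.Params) (j : ℕ) (s : ℝ) :
    P.mesh j ^ s = ((P.L : ℝ) ^ s) ^ j * P.mesh 0 ^ s := by
  have hL0 : (0 : ℝ) ≤ (P.L : ℝ) := Nat.cast_nonneg _
  rw [show P.mesh j = (P.L : ℝ) ^ j * P.mesh 0 by simp [HiggsLattice.Params.mesh],
    Real.mul_rpow (pow_nonneg hL0 j) (P.mesh_pos 0).le]
  congr 1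
  rw [← Real.rpow_natCast (P.L : ℝ) j, ← Real.rpow_mul hL0, mul_comm, Real.rpow_mul hL0, Real.rpow_natCast]

/-- `(L^jε)^s·(L^jε)^t = (L^jε)^{s+t}`. [cite: Balaban1983Higgs3, (2.10) p.426] -/
theorem mesh_rpow_add (P : HiggsLattice.Params) (j : ℕ) (s t : ℝ) : P.mesh j ^ s * P.mesh j ^ t = P.mesh j ^ (s + t) := by
  rw [Real.rpow_add (P.mesh_pos j)]

/-- `(L^jε)^{(n:ℝ)} = (L^jε)^n`. [cite: Balaban1983Higgs3, (2.10) p.426] -/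
theorem mesh_rpow_natCast (P : HiggsLattice.Params) (j n : ℕ) : P.mesh j ^ (n : ℝ) = P.mesh j ^ n :=
  Real.rpow_natCast _ _

/-- **The geometric scale sum, dominated by the top scale**: `Σ_{j<k}(L^jε)^s ≤ (L^kε)^s/(L^s − 1)` for `s > 0`, `L > 1`.
[cite: Balaban1983Higgs3, (2.6) p.424, (2.10) p.426] -/
theorem sum_mesh_rpow_le {s : ℝ} (hs : 0 < s) (hL : 1 < P.L) (k : ℕ) :
    ∑ j ∈ Finset.range k, P.mesh j ^ s ≤ P.mesh k ^ s / ((P.L : ℝ) ^ s - 1) := by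
  have hL1 : (1 : ℝ) < (P.L : ℝ) := by exact_mod_cast hL
  set r : ℝ := (P.L : ℝ) ^ s with hr
  have hr1 : 1 < r := Real.one_lt_rpow hL1 hs
  have hr0 : 0 < r - 1 := by linarith
  have hm0 : 0 ≤ P.mesh 0 ^ s := Real.rpow_nonneg (P.mesh_pos 0).le s
  have hsum : ∑ j ∈ Finset.range k, P.mesh j ^ s = P.mesh 0 ^ s * ∑ j ∈ Finset.range k, r ^ j := by
    rw [Finset.mul_sum]
    exact Finset.sum_congr rfl fun j _ => by rw [mesh_rpow_eq]; ring
  rw [hsum, geom_sum_eq hr1.ne' k, mesh_rpow_eq P k s, le_div_iff₀ hr0]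
  have : P.mesh 0 ^ s * ((r ^ k - 1) / (r - 1)) * (r - 1) = P.mesh 0 ^ s * (r ^ k - 1) := by
    field_simp
  rw [this, ← hr]
  nlinarith [pow_pos (lt_trans zero_lt_one hr1) k]

/-- **The nested two-scale sum**: `Σ_{j₂<k}Σ_{j₁≤j₂}(L^{j₁}ε)^a(L^{j₂}ε)^b ≤ L^a/((L^a − 1)(L^{a+b} − 1))·(L^kε)^{a+b}` for `a > 0`, `a + b > 0`
(`b` may be negative: the coarser factor may carry a negative power as long as the total is positive). [cite: Balaban1983Higgs3, (2.6) p.424, (2.10) p.426] -/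
theorem sum2_mesh_rpow_le {a b : ℝ} (ha : 0 < a) (hab : 0 < a + b) (hL : 1 < P.L) (k : ℕ) :
    ∑ j₂ ∈ Finset.range k, ∑ j₁ ∈ Finset.range (j₂ + 1), P.mesh j₁ ^ a * P.mesh j₂ ^ b
      ≤ (P.L : ℝ) ^ a / (((P.L : ℝ) ^ a - 1) * ((P.L : ℝ) ^ (a + b) - 1)) * P.mesh k ^ (a + b) := by
  have hL1 : (1 : ℝ) < (P.L : ℝ) := by exact_mod_cast hL
  have hL0 : (0 : ℝ) ≤ (P.L : ℝ) := Nat.cast_nonneg _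
  have hra : 0 < (P.L : ℝ) ^ a - 1 := by have := Real.one_lt_rpow hL1 ha; linarith
  have hrab : 0 < (P.L : ℝ) ^ (a + b) - 1 := by have := Real.one_lt_rpow hL1 hab; linarith
  -- the inner sums
  have hinner : ∀ j₂ : ℕ, ∑ j₁ ∈ Finset.range (j₂ + 1), P.mesh j₁ ^ a * P.mesh j₂ ^ b
      ≤ (P.L : ℝ) ^ a / ((P.L : ℝ) ^ a - 1) * P.mesh j₂ ^ (a + b) := by
    intro j₂
    rw [← Finset.sum_mul]
    have h1 := sum_mesh_rpow_le (P := P) ha hL (j₂ + 1)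
    have h2 : P.mesh (j₂ + 1) ^ a = (P.L : ℝ) ^ a * P.mesh j₂ ^ a := by
      rw [mesh_succ, Real.mul_rpow hL0 (P.mesh_pos j₂).le]
    rw [h2] at h1
    calc (∑ j₁ ∈ Finset.range (j₂ + 1), P.mesh j₁ ^ a) * P.mesh j₂ ^ b
        ≤ ((P.L : ℝ) ^ a * P.mesh j₂ ^ a / ((P.L : ℝ) ^ a - 1)) * P.mesh j₂ ^ b :=
          mul_le_mul_of_nonneg_right h1 (Real.rpow_nonneg (P.mesh_pos j₂).le b)
      _ = (P.L : ℝ) ^ a / ((P.L : ℝ) ^ a - 1) * (P.mesh j₂ ^ a * P.mesh j₂ ^ b) := by ring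
      _ = (P.L : ℝ) ^ a / ((P.L : ℝ) ^ a - 1) * P.mesh j₂ ^ (a + b) := by rw [mesh_rpow_add]
  calc ∑ j₂ ∈ Finset.range k, ∑ j₁ ∈ Finset.range (j₂ + 1), P.mesh j₁ ^ a * P.mesh j₂ ^ b
      ≤ ∑ j₂ ∈ Finset.range k, (P.L : ℝ) ^ a / ((P.L : ℝ) ^ a - 1) * P.mesh j₂ ^ (a + b) :=
        Finset.sum_le_sum fun j₂ _ => hinner j₂
    _ = (P.L : ℝ) ^ a / ((P.L : ℝ) ^ a - 1) * ∑ j₂ ∈ Finset.range k, P.mesh j₂ ^ (a + b) := by rw [Finset.mul_sum]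
    _ ≤ (P.L : ℝ) ^ a / ((P.L : ℝ) ^ a - 1) * (P.mesh k ^ (a + b) / ((P.L : ℝ) ^ (a + b) - 1)) :=
        mul_le_mul_of_nonneg_left (sum_mesh_rpow_le hab hL k) (div_nonneg (Real.rpow_nonneg hL0 a) hra.le)
    _ = _ := by
        field_simp

end ScaleSums

/-! ## §4 The `ℓ²`-column lemma: a kernel column with the (2.10) profile at every scale piece is square-summable, uniformly -/

section Columns

variable {k : ℕ}

/-- A site sum of a nonnegative function is below the corresponding sum over the coordinate indices `T × {1,…,N}` (`N ≥ 1`, witnessed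
by `i₀`). [cite: Balaban1982Higgs1, (1.5) p.604] -/
theorem sum_site_le_sum_idx {l : ℕ} (f : HiggsLattice.Site P l → ℝ) (hf : ∀ y, 0 ≤ f y) (i₀ : Ix N) :
    ∑ y, f y ≤ ∑ q : HiggsLattice.Site P l × Ix N, f q.1 := by
  rw [Fintype.sum_prod_type]
  refine Finset.sum_le_sum fun y _ => ?_
  simp only [Finset.sum_const, Finset.card_univ, nsmul_eq_mul]
  have h1 : (1 : ℝ) ≤ (Fintype.card (Ix N) : ℝ) := by
    exact_mod_cast Fintype.card_pos_iff.mpr ⟨i₀⟩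
  nlinarith [hf y]

/-- The (2.10) exponent in the model's units is the rate `δ/L^j` on the lattice distance: `δ(L^jε)^{−1}·ε|y−x| = (δ/L^j)|y−x|`.
[cite: Balaban1983Higgs3, (2.10) p.426] -/
theorem rate_eq (P : HiggsLattice.Params) (j : ℕ) (δ t : ℝ) :
    δ * (P.mesh j)⁻¹ * (P.mesh 0 * t) = δ / (P.L : ℝ) ^ j * t := by
  rw [show P.mesh j = (P.L : ℝ) ^ j * P.mesh 0 by simp [HiggsLattice.Params.mesh]]
  have h0 : P.mesh 0 ≠ 0 := (P.mesh_pos 0).ne'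
  have hL : ((P.L : ℝ) ^ j) ≠ 0 := pow_ne_zero _ (by have := P.hL; exact_mod_cast this.ne')
  field_simp

/-- **One scale piece of a column**: if `|K(y)| ≤ c(L^jε)^{2−d}e^{−δ(L^jε)^{−1}ε|y−x|}` for all `y`, then
`Σ_y ε^d K(y)² ≤ c²·N(4d/δ)^d·(L^jε)^{4−d}` (`0 < δ ≤ 1/2`). [cite: Balaban1983Higgs3, (2.10) p.426] [cite: Balaban1983RegularityDecay, Sect. 5 Theorem p.594] -/
theorem sq_col_piece_le {c δ : ℝ} (hc : 0 ≤ c) (hδ : 0 < δ) (hδ2 : δ ≤ 1 / 2) (j : ℕ) (x : HiggsLattice.Site P 0) (i₀ : Ix N)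
    (K : HiggsLattice.Site P 0 → ℝ)
    (hK : ∀ y, |K y| ≤ c * P.mesh j ^ ((2 : ℝ) - (P.d : ℝ)) *
      Real.exp (-(δ * (P.mesh j)⁻¹ * (P.mesh 0 * (HiggsLattice.Site.tdist y x : ℝ))))) :
    ∑ y, P.mesh 0 ^ P.d * K y ^ 2
      ≤ c ^ 2 * ((nCol N : ℝ) * (4 * P.d / δ) ^ P.d) * P.mesh j ^ ((4 : ℝ) - (P.d : ℝ)) := by
  have hmj : 0 < P.mesh j := P.mesh_pos j
  have hm0 : 0 < P.mesh 0 := P.mesh_pos 0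
  set A : ℝ := c * P.mesh j ^ ((2 : ℝ) - (P.d : ℝ)) with hA
  have hA0 : 0 ≤ A := mul_nonneg hc (Real.rpow_nonneg hmj.le _)
  -- termwise: K² ≤ A² e^{−rate}
  have hterm : ∀ y, P.mesh 0 ^ P.d * K y ^ 2
      ≤ A ^ 2 * (P.mesh 0 ^ P.d * Real.exp (-(δ / (P.L : ℝ) ^ j * (HiggsLattice.Site.tdist x y : ℝ)))) := by
    intro y
    have h := hK y
    rw [rate_eq, tdist_comm y x] at h
    set E : ℝ := Real.exp (-(δ / (P.L : ℝ) ^ j * (HiggsLattice.Site.tdist x y : ℝ))) with hE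
    have hE1 : E ≤ 1 := Real.exp_le_one_iff.mpr (by
      have : 0 ≤ δ / (P.L : ℝ) ^ j * (HiggsLattice.Site.tdist x y : ℝ) :=
        mul_nonneg (div_nonneg hδ.le (pow_nonneg (Nat.cast_nonneg _) _)) (Nat.cast_nonneg _)
      linarith)
    have hE0 : 0 ≤ E := (Real.exp_pos _).le
    have hK2 : K y ^ 2 ≤ (A * E) ^ 2 := by
      have : |K y| ≤ A * E := h
      calc K y ^ 2 = |K y| ^ 2 := (sq_abs _).symm
        _ ≤ (A * E) ^ 2 := pow_le_pow_left₀ (abs_nonneg _) this 2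
    have hAE : (A * E) ^ 2 ≤ A ^ 2 * E := by
      rw [mul_pow]
      exact mul_le_mul_of_nonneg_left (by nlinarith) (sq_nonneg _)
    calc P.mesh 0 ^ P.d * K y ^ 2 ≤ P.mesh 0 ^ P.d * (A ^ 2 * E) :=
          mul_le_mul_of_nonneg_left (hK2.trans hAE) (pow_nonneg hm0.le _)
      _ = A ^ 2 * (P.mesh 0 ^ P.d * E) := by ring
  -- the lattice sum at scale j
  have hsum : ∑ y, P.mesh 0 ^ P.d * Real.exp (-(δ / (P.L : ℝ) ^ j * (HiggsLattice.Site.tdist x y : ℝ)))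
      ≤ P.mesh 0 ^ P.d * ((nCol N : ℝ) * (4 * P.d / δ) ^ P.d * ((P.L : ℝ) ^ j) ^ P.d) := by
    rw [← Finset.mul_sum]
    refine mul_le_mul_of_nonneg_left ?_ (pow_nonneg hm0.le _)
    refine (sum_site_le_sum_idx (fun y => Real.exp (-(δ / (P.L : ℝ) ^ j * (HiggsLattice.Site.tdist x y : ℝ))))
      (fun y => (Real.exp_pos _).le) i₀).trans ?_
    exact sum_exp_scale_le hδ hδ2 j x i₀
  -- `ε^d (L^j)^d = (L^jε)^d` and the exponents
  have hvol : P.mesh 0 ^ P.d * ((P.L : ℝ) ^ j) ^ P.d = P.mesh j ^ P.d := by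
    rw [show P.mesh j = (P.L : ℝ) ^ j * P.mesh 0 by simp [HiggsLattice.Params.mesh], mul_pow, mul_comm]
  have hexp : P.mesh j ^ ((2 : ℝ) - (P.d : ℝ)) * P.mesh j ^ ((2 : ℝ) - (P.d : ℝ)) * P.mesh j ^ P.d
      = P.mesh j ^ ((4 : ℝ) - (P.d : ℝ)) := by
    rw [← mesh_rpow_natCast, mesh_rpow_add, mesh_rpow_add]
    congr 1; ring
  calc ∑ y, P.mesh 0 ^ P.d * K y ^ 2
      ≤ ∑ y, A ^ 2 * (P.mesh 0 ^ P.d * Real.exp (-(δ / (P.L : ℝ) ^ j * (HiggsLattice.Site.tdist x y : ℝ)))) :=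
        Finset.sum_le_sum fun y _ => hterm y
    _ = A ^ 2 * ∑ y, P.mesh 0 ^ P.d * Real.exp (-(δ / (P.L : ℝ) ^ j * (HiggsLattice.Site.tdist x y : ℝ))) := by
        rw [Finset.mul_sum]
    _ ≤ A ^ 2 * (P.mesh 0 ^ P.d * ((nCol N : ℝ) * (4 * P.d / δ) ^ P.d * ((P.L : ℝ) ^ j) ^ P.d)) :=
        mul_le_mul_of_nonneg_left hsum (sq_nonneg _)
    _ = c ^ 2 * ((nCol N : ℝ) * (4 * P.d / δ) ^ P.d) *
          (P.mesh j ^ ((2 : ℝ) - (P.d : ℝ)) * P.mesh j ^ ((2 : ℝ) - (P.d : ℝ)) * (P.mesh 0 ^ P.d * ((P.L : ℝ) ^ j) ^ P.d)) := by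
        rw [hA]; ring
    _ = c ^ 2 * ((nCol N : ℝ) * (4 * P.d / δ) ^ P.d) * P.mesh j ^ ((4 : ℝ) - (P.d : ℝ)) := by
        rw [hvol, hexp]

/-- Cauchy–Schwarz with positive weights: `(Σ_j a_j)² ≤ (Σ_j θ_j)·(Σ_j a_j²/θ_j)`. [cite: Balaban1983Higgs3, (2.6) p.424] -/
theorem sq_sum_le_weighted (S : Finset ℕ) (a θ : ℕ → ℝ) (hθ : ∀ j ∈ S, 0 < θ j) :
    (∑ j ∈ S, a j) ^ 2 ≤ (∑ j ∈ S, θ j) * ∑ j ∈ S, a j ^ 2 / θ j := by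
  have h := Finset.sum_mul_sq_le_sq_mul_sq S (fun j => Real.sqrt (θ j)) (fun j => a j / Real.sqrt (θ j))
  have hfg : ∀ j ∈ S, Real.sqrt (θ j) * (a j / Real.sqrt (θ j)) = a j := by
    intro j hj
    have : 0 < Real.sqrt (θ j) := Real.sqrt_pos.mpr (hθ j hj)
    field_simp
  have hf : ∀ j ∈ S, Real.sqrt (θ j) ^ 2 = θ j := fun j hj => Real.sq_sqrt (hθ j hj).le
  have hg : ∀ j ∈ S, (a j / Real.sqrt (θ j)) ^ 2 = a j ^ 2 / θ j := by
    intro j hj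
    rw [div_pow, Real.sq_sqrt (hθ j hj).le]
  rw [Finset.sum_congr rfl hfg, Finset.sum_congr rfl hf, Finset.sum_congr rfl hg] at h
  exact h

/-- **THE `ℓ²`-COLUMN LEMMA** (`d ≤ 3`): if a kernel column is a sum over the scale pieces `j < k` of (2.6), each with the (2.10) value
profile `|K_j(y)| ≤ c(L^jε)^{2−d}e^{−δ(L^jε)^{−1}ε|y−x|}`, then it is square-summable uniformly in `k` and in the volume:
`Σ_y ε^d(Σ_{j<k}|K_j(y)|)² ≤ c²·N(4d/δ)^d·(L^{(4−d)/2} − 1)^{−2}·(L^kε)^{4−d}` — the outer propagator factors of the chains of (1.16) have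
`ℓ²` kernel columns (Cauchy–Schwarz with the weights `(L^jε/L^kε)^{(4−d)/2}`, one scale at a time by `sq_col_piece_le`, and the geometric scale
sum `sum_mesh_rpow_le`). [cite: Balaban1983Higgs3, (1.16) p.414, (2.6) p.424, (2.10) p.426] -/
theorem sq_col_le (hL : 1 < P.L) (hd3 : P.d ≤ 3) {c δ : ℝ} (hc : 0 ≤ c) (hδ : 0 < δ) (hδ2 : δ ≤ 1 / 2)
    (x : HiggsLattice.Site P 0) (i₀ : Ix N) (K : ℕ → HiggsLattice.Site P 0 → ℝ)
    (hK : ∀ j, j < k → ∀ y, |K j y| ≤ c * P.mesh j ^ ((2 : ℝ) - (P.d : ℝ)) *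
      Real.exp (-(δ * (P.mesh j)⁻¹ * (P.mesh 0 * (HiggsLattice.Site.tdist y x : ℝ))))) :
    ∑ y, P.mesh 0 ^ P.d * (∑ j ∈ Finset.range k, |K j y|) ^ 2
      ≤ c ^ 2 * ((nCol N : ℝ) * (4 * P.d / δ) ^ P.d) / ((P.L : ℝ) ^ (((4 : ℝ) - (P.d : ℝ)) / 2) - 1) ^ 2 *
          P.mesh k ^ ((4 : ℝ) - (P.d : ℝ)) := by
  have hL1 : (1 : ℝ) < (P.L : ℝ) := by exact_mod_cast hL
  have hm0 : 0 < P.mesh 0 := P.mesh_pos 0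
  have hmk : 0 < P.mesh k := P.mesh_pos k
  set σ : ℝ := ((4 : ℝ) - (P.d : ℝ)) / 2 with hσdef
  have hd3' : (P.d : ℝ) ≤ 3 := by exact_mod_cast hd3
  have hσ : 0 < σ := by rw [hσdef]; linarith
  have hσ2 : σ + σ = (4 : ℝ) - (P.d : ℝ) := by rw [hσdef]; ring
  set r : ℝ := (P.L : ℝ) ^ σ with hr
  have hr1 : 1 < r := Real.one_lt_rpow hL1 hσ
  have hr0 : 0 < r - 1 := by linarith
  -- the weights
  set θ : ℕ → ℝ := fun j => P.mesh j ^ σ / P.mesh k ^ σ with hθ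
  have hθpos : ∀ j, 0 < θ j := fun j => div_pos (Real.rpow_pos_of_pos (P.mesh_pos j) σ) (Real.rpow_pos_of_pos hmk σ)
  have hΘ : ∑ j ∈ Finset.range k, θ j ≤ 1 / (r - 1) := by
    have h := sum_mesh_rpow_le (P := P) hσ hL k
    simp only [hθ]
    rw [← Finset.sum_div, div_le_iff₀ (Real.rpow_pos_of_pos hmk σ)]
    calc ∑ j ∈ Finset.range k, P.mesh j ^ σ ≤ P.mesh k ^ σ / (r - 1) := h
      _ = 1 / (r - 1) * P.mesh k ^ σ := by ring
  -- per scale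
  set B : ℝ := c ^ 2 * ((nCol N : ℝ) * (4 * P.d / δ) ^ P.d) with hB
  have hB0 : 0 ≤ B := by
    have : 0 ≤ (4 * (P.d : ℝ) / δ) ^ P.d := pow_nonneg (by positivity) _
    positivity
  have hpiece : ∀ j ∈ Finset.range k, ∑ y, P.mesh 0 ^ P.d * K j y ^ 2 ≤ B * P.mesh j ^ ((4 : ℝ) - (P.d : ℝ)) := by
    intro j hj
    exact sq_col_piece_le hc hδ hδ2 j x i₀ (K j) (hK j (Finset.mem_range.mp hj))
  -- Cauchy–Schwarz per site, then swap the sums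
  have hCS : ∀ y, P.mesh 0 ^ P.d * (∑ j ∈ Finset.range k, |K j y|) ^ 2
      ≤ (1 / (r - 1)) * ∑ j ∈ Finset.range k, P.mesh 0 ^ P.d * K j y ^ 2 / θ j := by
    intro y
    have h := sq_sum_le_weighted (Finset.range k) (fun j => |K j y|) θ (fun j _ => hθpos j)
    simp only [sq_abs] at h
    calc P.mesh 0 ^ P.d * (∑ j ∈ Finset.range k, |K j y|) ^ 2
        ≤ P.mesh 0 ^ P.d * ((∑ j ∈ Finset.range k, θ j) * ∑ j ∈ Finset.range k, K j y ^ 2 / θ j) :=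
          mul_le_mul_of_nonneg_left h (pow_nonneg hm0.le _)
      _ ≤ P.mesh 0 ^ P.d * ((1 / (r - 1)) * ∑ j ∈ Finset.range k, K j y ^ 2 / θ j) := by
          refine mul_le_mul_of_nonneg_left (mul_le_mul_of_nonneg_right hΘ ?_) (pow_nonneg hm0.le _)
          exact Finset.sum_nonneg fun j _ => div_nonneg (sq_nonneg _) (hθpos j).le
      _ = (1 / (r - 1)) * ∑ j ∈ Finset.range k, P.mesh 0 ^ P.d * K j y ^ 2 / θ j := by
          rw [Finset.mul_sum, Finset.mul_sum, Finset.mul_sum]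
          exact Finset.sum_congr rfl fun j _ => by ring
  -- the scale sum of the per-scale bounds divided by the weights
  have hinv : ∀ j ∈ Finset.range k, B * P.mesh j ^ ((4 : ℝ) - (P.d : ℝ)) / θ j = B * P.mesh k ^ σ * P.mesh j ^ σ := by
    intro j _
    have hjσ : 0 < P.mesh j ^ σ := Real.rpow_pos_of_pos (P.mesh_pos j) σ
    simp only [hθ]
    rw [← hσ2, ← mesh_rpow_add]
    field_simp
  have hscale : ∑ j ∈ Finset.range k, B * P.mesh j ^ ((4 : ℝ) - (P.d : ℝ)) / θ j
      ≤ B * P.mesh k ^ σ * (P.mesh k ^ σ / (r - 1)) := by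
    rw [Finset.sum_congr rfl hinv, ← Finset.mul_sum]
    exact mul_le_mul_of_nonneg_left (sum_mesh_rpow_le hσ hL k) (mul_nonneg hB0 (Real.rpow_nonneg hmk.le σ))
  -- assemble
  calc ∑ y, P.mesh 0 ^ P.d * (∑ j ∈ Finset.range k, |K j y|) ^ 2
      ≤ ∑ y, (1 / (r - 1)) * ∑ j ∈ Finset.range k, P.mesh 0 ^ P.d * K j y ^ 2 / θ j :=
        Finset.sum_le_sum fun y _ => hCS y
    _ = (1 / (r - 1)) * ∑ j ∈ Finset.range k, (∑ y, P.mesh 0 ^ P.d * K j y ^ 2) / θ j := by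
        rw [← Finset.mul_sum, Finset.sum_comm]
        congr 1
        exact Finset.sum_congr rfl fun j _ => by rw [Finset.sum_div]
    _ ≤ (1 / (r - 1)) * ∑ j ∈ Finset.range k, B * P.mesh j ^ ((4 : ℝ) - (P.d : ℝ)) / θ j := by
        refine mul_le_mul_of_nonneg_left (Finset.sum_le_sum fun j hj => ?_) (by positivity)
        exact div_le_div_of_nonneg_right (hpiece j hj) (hθpos j).le
    _ ≤ (1 / (r - 1)) * (B * P.mesh k ^ σ * (P.mesh k ^ σ / (r - 1))) :=
        mul_le_mul_of_nonneg_left hscale (by positivity)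
    _ = B / (r - 1) ^ 2 * (P.mesh k ^ σ * P.mesh k ^ σ) := by
        field_simp
    _ = B / (r - 1) ^ 2 * P.mesh k ^ ((4 : ℝ) - (P.d : ℝ)) := by rw [mesh_rpow_add, hσ2]

end Columns

/-! ## §5 (v1.1) Chains of three kernels across all scales: the volume of a scale triple and the FACTORIZED scale sum -/

section Chains

variable {k : ℕ}

/-- The volume exponent of a scale triple: `min(j₂,j₃) + min(j₁, max(j₂,j₃)) + max(j₁,j₂,j₃) = j₁ + j₂ + j₃` — convolving three bumps
costs the volumes of all scales but the largest. [cite: Balaban1983Higgs3, (2.6) p.424] -/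
theorem min_add_min_add_max (j₁ j₂ j₃ : ℕ) :
    min j₂ j₃ + min j₁ (max j₂ j₃) + max j₁ (max j₂ j₃) = j₁ + j₂ + j₃ := by
  omega

/-- The profile at half the rate of scale `j`: `K(δ/(2L^j)) ≤ N·(8d/δ)^d·(L^j)^d` (`0 < δ ≤ 1`).
[cite: Balaban1983RegularityDecay, Sect. 5 Theorem p.594] -/
theorem profile_half_scale_le {δ : ℝ} (hδ : 0 < δ) (hδ1 : δ ≤ 1) (j : ℕ) :
    profile P N (δ / (P.L : ℝ) ^ j / 2) ≤ (nCol N : ℝ) * (8 * P.d / δ) ^ P.d * ((P.L : ℝ) ^ j) ^ P.d := by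
  have hL : (1 : ℝ) ≤ (P.L : ℝ) ^ j := one_le_pow₀ (by exact_mod_cast P.hL)
  have hLpos : (0 : ℝ) < (P.L : ℝ) ^ j := by positivity
  have ha : 0 < δ / (P.L : ℝ) ^ j / 2 := by positivity
  have ha2 : δ / (P.L : ℝ) ^ j / 2 ≤ 1 / 2 := by
    have : δ / (P.L : ℝ) ^ j ≤ 1 := (div_le_self hδ.le hL).trans hδ1
    linarith
  refine (profile_le_pow ha ha2).trans (le_of_eq ?_)
  rw [mul_assoc]
  congr 1
  rw [← mul_pow]
  congr 1
  field_simp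
  ring

/-- The profile at a quarter of the rate of scale `j`: `K(δ/(4L^j)) ≤ N·(16d/δ)^d·(L^j)^d` (`0 < δ ≤ 1`).
[cite: Balaban1983RegularityDecay, Sect. 5 Theorem p.594] -/
theorem profile_quarter_scale_le {δ : ℝ} (hδ : 0 < δ) (hδ1 : δ ≤ 1) (j : ℕ) :
    profile P N (δ / (P.L : ℝ) ^ j / 4) ≤ (nCol N : ℝ) * (16 * P.d / δ) ^ P.d * ((P.L : ℝ) ^ j) ^ P.d := by
  have hL : (1 : ℝ) ≤ (P.L : ℝ) ^ j := one_le_pow₀ (by exact_mod_cast P.hL)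
  have hLpos : (0 : ℝ) < (P.L : ℝ) ^ j := by positivity
  have ha : 0 < δ / (P.L : ℝ) ^ j / 4 := by positivity
  have ha2 : δ / (P.L : ℝ) ^ j / 4 ≤ 1 / 2 := by
    have : δ / (P.L : ℝ) ^ j ≤ 1 := (div_le_self hδ.le hL).trans hδ1
    linarith
  refine (profile_le_pow ha ha2).trans (le_of_eq ?_)
  rw [mul_assoc]
  congr 1
  rw [← mul_pow]
  congr 1
  field_simp
  ring

/-- **Three kernels on three scales**: for rates `δ/L^{j₁}, δ/L^{j₂}, δ/L^{j₃}` (`0 < δ ≤ 1`),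
`Σ_{s,t} e^{−(δ/L^{j₁})|u−s|}e^{−(δ/L^{j₂})|s−t|}e^{−(δ/L^{j₃})|t−v|} ≤ N²(8d/δ)^d(16d/δ)^d·(L^{j₁+j₂+j₃−j_max})^d·e^{−(δ/(4L^{j_max}))|u−v|}`,
`j_max = max(j₁,j₂,j₃)`: the volumes of the two finer scales, the decay of the coarsest (from `conv3_le` and the antitonicity of the profile).
[cite: Balaban1983Higgs3, (2.6) p.424, (2.10) p.426] [cite: Balaban1983RegularityDecay, Sect. 5 Theorem p.594] -/
theorem conv3_scales_le {δ : ℝ} (hδ : 0 < δ) (hδ1 : δ ≤ 1) (j₁ j₂ j₃ : ℕ) (u v : HiggsLattice.Site P k) (i₀ : Ix N) :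
    ∑ s : HiggsLattice.Site P k × Ix N, ∑ t : HiggsLattice.Site P k × Ix N,
        Real.exp (-(δ / (P.L : ℝ) ^ j₁ * (HiggsLattice.Site.tdist u s.1 : ℝ))) *
          Real.exp (-(δ / (P.L : ℝ) ^ j₂ * (HiggsLattice.Site.tdist s.1 t.1 : ℝ))) *
          Real.exp (-(δ / (P.L : ℝ) ^ j₃ * (HiggsLattice.Site.tdist t.1 v : ℝ)))
      ≤ ((nCol N : ℝ) * (8 * P.d / δ) ^ P.d) * ((nCol N : ℝ) * (16 * P.d / δ) ^ P.d) *
          ((P.L : ℝ) ^ (j₁ + j₂ + j₃ - max j₁ (max j₂ j₃))) ^ P.d *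
          Real.exp (-(δ / (P.L : ℝ) ^ (max j₁ (max j₂ j₃)) / 4 * (HiggsLattice.Site.tdist u v : ℝ))) := by
  have hL1 : (1 : ℝ) ≤ (P.L : ℝ) := by exact_mod_cast P.hL
  have hL0 : (0 : ℝ) < (P.L : ℝ) := by positivity
  -- the rates
  set a : ℝ := δ / (P.L : ℝ) ^ j₁ with ha_def
  set b : ℝ := δ / (P.L : ℝ) ^ j₂ with hb_def
  set c : ℝ := δ / (P.L : ℝ) ^ j₃ with hc_def
  have ha : 0 < a := by positivity
  have hb : 0 < b := by positivity
  have hc : 0 < c := by positivity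
  have h3 := conv3_le (P := P) (N := N) ha hb hc u v i₀
  -- `δ/L^j` is antitone in `j`
  have rate_anti : ∀ {i j : ℕ}, i ≤ j → δ / (P.L : ℝ) ^ j ≤ δ / (P.L : ℝ) ^ i := fun {i j} hij =>
    div_le_div_of_nonneg_left hδ.le (by positivity) (pow_le_pow_right₀ hL1 hij)
  have rate_min : ∀ i j : ℕ, max (δ / (P.L : ℝ) ^ i) (δ / (P.L : ℝ) ^ j) = δ / (P.L : ℝ) ^ (min i j) := by
    intro i j
    rcases le_total i j with hij | hji
    · rw [min_eq_left hij, max_eq_left (rate_anti hij)]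
    · rw [min_eq_right hji, max_eq_right (rate_anti hji)]
  have rate_max : ∀ i j : ℕ, min (δ / (P.L : ℝ) ^ i) (δ / (P.L : ℝ) ^ j) = δ / (P.L : ℝ) ^ (max i j) := by
    intro i j
    rcases le_total i j with hij | hji
    · rw [max_eq_right hij, min_eq_right (rate_anti hij)]
    · rw [max_eq_left hji, min_eq_left (rate_anti hji)]
  -- first profile: the finer of scales 2, 3
  have hP1 : profile P N (max b c / 2) ≤ (nCol N : ℝ) * (8 * P.d / δ) ^ P.d * ((P.L : ℝ) ^ (min j₂ j₃)) ^ P.d := by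
    rw [hb_def, hc_def, rate_min]
    exact profile_half_scale_le hδ hδ1 _
  -- second profile: rate `max a (min b c / 2) ≥ δ/(2L^m)`, `m = min j₁ (max j₂ j₃)`
  set m : ℕ := min j₁ (max j₂ j₃) with hm
  have hq : δ / (P.L : ℝ) ^ m / 2 ≤ max a (min b c / 2) := by
    rw [hb_def, hc_def, rate_max]
    rcases le_total j₁ (max j₂ j₃) with h1 | h2
    · have : m = j₁ := by rw [hm, min_eq_left h1]
      rw [this, ha_def]
      refine le_trans ?_ (le_max_left _ _)
      have : 0 ≤ δ / (P.L : ℝ) ^ j₁ := by positivity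
      linarith
    · have : m = max j₂ j₃ := by rw [hm, min_eq_right h2]
      rw [this]
      exact le_max_right _ _
  have hqpos : 0 < δ / (P.L : ℝ) ^ m / 2 / 2 := by positivity
  have hP2 : profile P N (max a (min b c / 2) / 2) ≤ (nCol N : ℝ) * (16 * P.d / δ) ^ P.d * ((P.L : ℝ) ^ m) ^ P.d := by
    refine (profile_antitone hqpos (by linarith)).trans ?_
    have : δ / (P.L : ℝ) ^ m / 2 / 2 = δ / (P.L : ℝ) ^ m / 4 := by ring
    rw [this]
    exact profile_quarter_scale_le hδ hδ1 m
  -- decay: `min a (min b c / 2) / 2 ≥ δ/(4 L^{jmax})`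
  set jm : ℕ := max j₁ (max j₂ j₃) with hjm
  have hdec : δ / (P.L : ℝ) ^ jm / 4 ≤ min a (min b c / 2) / 2 := by
    rw [hb_def, hc_def, rate_max]
    have h1 : δ / (P.L : ℝ) ^ jm ≤ a := by rw [ha_def]; exact rate_anti (le_max_left _ _)
    have h2 : δ / (P.L : ℝ) ^ jm ≤ δ / (P.L : ℝ) ^ (max j₂ j₃) := rate_anti (le_max_right _ _)
    have h0 : 0 ≤ δ / (P.L : ℝ) ^ jm := by positivity
    rcases le_total a (δ / (P.L : ℝ) ^ (max j₂ j₃) / 2) with hle | hge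
    · rw [min_eq_left hle]; linarith
    · rw [min_eq_right hge]; linarith
  have hexp : Real.exp (-(min a (min b c / 2) / 2 * (HiggsLattice.Site.tdist u v : ℝ)))
      ≤ Real.exp (-(δ / (P.L : ℝ) ^ jm / 4 * (HiggsLattice.Site.tdist u v : ℝ))) :=
    Real.exp_le_exp.mpr (by
      have : (0 : ℝ) ≤ (HiggsLattice.Site.tdist u v : ℝ) := Nat.cast_nonneg _
      nlinarith)
  -- volumes: `(L^{min j₂ j₃})^d (L^m)^d = (L^{Σj − jmax})^d`
  have hvol : ((P.L : ℝ) ^ (min j₂ j₃)) ^ P.d * ((P.L : ℝ) ^ m) ^ P.d = ((P.L : ℝ) ^ (j₁ + j₂ + j₃ - jm)) ^ P.d := by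
    rw [← mul_pow, ← pow_add]
    congr 2
    have := min_add_min_add_max j₁ j₂ j₃
    omega
  have hK1 : 0 ≤ (nCol N : ℝ) * (8 * P.d / δ) ^ P.d * ((P.L : ℝ) ^ (min j₂ j₃)) ^ P.d := by positivity
  have hK2 : 0 ≤ (nCol N : ℝ) * (16 * P.d / δ) ^ P.d * ((P.L : ℝ) ^ m) ^ P.d := by positivity
  have hP20 : 0 ≤ profile P N (max a (min b c / 2) / 2) :=
    profile_nonneg' _ (by have := le_max_left a (min b c / 2); linarith)
  calc _ ≤ profile P N (max b c / 2) * profile P N (max a (min b c / 2) / 2) *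
          Real.exp (-(min a (min b c / 2) / 2 * (HiggsLattice.Site.tdist u v : ℝ))) := h3
    _ ≤ ((nCol N : ℝ) * (8 * P.d / δ) ^ P.d * ((P.L : ℝ) ^ (min j₂ j₃)) ^ P.d) *
          ((nCol N : ℝ) * (16 * P.d / δ) ^ P.d * ((P.L : ℝ) ^ m) ^ P.d) *
          Real.exp (-(δ / (P.L : ℝ) ^ jm / 4 * (HiggsLattice.Site.tdist u v : ℝ))) := by
        refine mul_le_mul (mul_le_mul hP1 hP2 hP20 hK1) hexp (Real.exp_pos _).le (mul_nonneg hK1 hK2)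
    _ = ((nCol N : ℝ) * (8 * P.d / δ) ^ P.d) * ((nCol N : ℝ) * (16 * P.d / δ) ^ P.d) *
          (((P.L : ℝ) ^ (min j₂ j₃)) ^ P.d * ((P.L : ℝ) ^ m) ^ P.d) *
          Real.exp (-(δ / (P.L : ℝ) ^ jm / 4 * (HiggsLattice.Site.tdist u v : ℝ))) := by ring
    _ = _ := by rw [hvol]

/-- **The largest scale dominates a weighted geometric mean**: for `j_i ≤ j_max` and `θ` on the simplex,
`(L^{j_max}ε)^{−d} ≤ Π_i (L^{j_i}ε)^{−dθ_i}` (three factors). [cite: Balaban1983Higgs3, (2.6) p.424] -/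
theorem rpow_top_le_prod3 {jm j₁ j₂ j₃ : ℕ} (h₁ : j₁ ≤ jm) (h₂ : j₂ ≤ jm) (h₃ : j₃ ≤ jm)
    {θ₁ θ₂ θ₃ : ℝ} (hθ₁ : 0 ≤ θ₁) (hθ₂ : 0 ≤ θ₂) (hθ₃ : 0 ≤ θ₃) (hθ : θ₁ + θ₂ + θ₃ = 1) :
    (P.mesh jm ^ P.d)⁻¹ ≤
      P.mesh j₁ ^ (-((P.d : ℝ) * θ₁)) * P.mesh j₂ ^ (-((P.d : ℝ) * θ₂)) * P.mesh j₃ ^ (-((P.d : ℝ) * θ₃)) := by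
  have hm : ∀ j, 0 < P.mesh j := P.mesh_pos
  have hmono : ∀ {i j : ℕ}, i ≤ j → P.mesh i ≤ P.mesh j := fun {i j} hij => by
    unfold HiggsLattice.Params.mesh
    exact mul_le_mul_of_nonneg_right (pow_le_pow_right₀ (by exact_mod_cast P.hL) hij) P.hε.le
  -- each factor dominates the corresponding power of the top scale
  have hfac : ∀ {j : ℕ} {θ : ℝ}, j ≤ jm → 0 ≤ θ →
      P.mesh jm ^ (-((P.d : ℝ) * θ)) ≤ P.mesh j ^ (-((P.d : ℝ) * θ)) :=
    fun {j θ} hj hθ0 => Real.rpow_le_rpow_of_nonpos (hm j) (hmono hj) (by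
      have : 0 ≤ (P.d : ℝ) * θ := mul_nonneg (Nat.cast_nonneg _) hθ0
      linarith)
  have hsplit : (P.mesh jm ^ P.d)⁻¹ =
      P.mesh jm ^ (-((P.d : ℝ) * θ₁)) * P.mesh jm ^ (-((P.d : ℝ) * θ₂)) * P.mesh jm ^ (-((P.d : ℝ) * θ₃)) := by
    rw [← Real.rpow_add (hm jm), ← Real.rpow_add (hm jm), ← Real.rpow_natCast, ← Real.rpow_neg (hm jm).le]
    congr 1
    have : -((P.d : ℝ) * θ₁) + -((P.d : ℝ) * θ₂) + -((P.d : ℝ) * θ₃) = -((P.d : ℝ) * (θ₁ + θ₂ + θ₃)) := by ring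
    rw [this, hθ, mul_one]
  rw [hsplit]
  have h0 : ∀ (j : ℕ) (t : ℝ), 0 ≤ P.mesh j ^ t := fun j t => Real.rpow_nonneg (hm j).le t
  exact mul_le_mul (mul_le_mul (hfac h₁ hθ₁) (hfac h₂ hθ₂) (h0 _ _) (h0 _ _)) (hfac h₃ hθ₃) (h0 _ _)
    (mul_nonneg (h0 _ _) (h0 _ _))

/-- **THE FACTORIZED TRIPLE SCALE SUM**: for exponents `a_i > 0` with `a₁ + a₂ + a₃ > d`,
`Σ_{j₁,j₂,j₃<k} (L^{j₁}ε)^{a₁}(L^{j₂}ε)^{a₂}(L^{j₃}ε)^{a₃}·(L^{j_max}ε)^{−d} ≤ Π_i ((L^{a_is} − 1)^{−1})·(L^kε)^{a₁+a₂+a₃−d}`, `s = 1 − d/(a₁+a₂+a₃)`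
— with `θ_i = a_i/Σa` in `rpow_top_le_prod3` the sum splits into three geometric sums with the positive exponents `a_is`; this is the
closed form of the order count behind «n, n′ sufficiently large» (every undifferentiated propagator factor contributes `a = 2`, every
derivative lowers it by one; the kernel of the chain is bounded as soon as `Σa_i > d`). [cite: Balaban1983Higgs3, (1.16) p.414, (2.6) p.424, (2.10) p.426] -/
theorem sum3_scales_le (hL : 1 < P.L) {a₁ a₂ a₃ : ℝ} (ha₁ : 0 < a₁) (ha₂ : 0 < a₂) (ha₃ : 0 < a₃)
    (hsum : (P.d : ℝ) < a₁ + a₂ + a₃) :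
    ∑ j₁ ∈ Finset.range k, ∑ j₂ ∈ Finset.range k, ∑ j₃ ∈ Finset.range k,
        P.mesh j₁ ^ a₁ * P.mesh j₂ ^ a₂ * P.mesh j₃ ^ a₃ * (P.mesh (max j₁ (max j₂ j₃)) ^ P.d)⁻¹
      ≤ (1 / ((P.L : ℝ) ^ (a₁ * (1 - (P.d : ℝ) / (a₁ + a₂ + a₃))) - 1)) *
        (1 / ((P.L : ℝ) ^ (a₂ * (1 - (P.d : ℝ) / (a₁ + a₂ + a₃))) - 1)) *
        (1 / ((P.L : ℝ) ^ (a₃ * (1 - (P.d : ℝ) / (a₁ + a₂ + a₃))) - 1)) *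
        P.mesh k ^ (a₁ + a₂ + a₃ - (P.d : ℝ)) := by
  have hm : ∀ j, 0 < P.mesh j := P.mesh_pos
  set A : ℝ := a₁ + a₂ + a₃ with hA
  have hA0 : 0 < A := by rw [hA]; linarith
  set s : ℝ := 1 - (P.d : ℝ) / A with hs
  have hs0 : 0 < s := by
    rw [hs, sub_pos, div_lt_one hA0]; exact hsum
  -- the simplex weights
  have hθ : a₁ / A + a₂ / A + a₃ / A = 1 := by
    rw [← add_div, ← add_div, div_eq_one_iff_eq hA0.ne']
  have hθi : ∀ {a : ℝ}, 0 < a → 0 ≤ a / A := fun {a} ha => div_nonneg ha.le hA0.le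
  -- the exponents after absorbing the top scale: `a_i − dθ_i = a_i s`
  have hexp : ∀ a : ℝ, a + -((P.d : ℝ) * (a / A)) = a * s := by
    intro a; rw [hs]; field_simp; ring
  -- termwise bound
  have hterm : ∀ j₁ ∈ Finset.range k, ∀ j₂ ∈ Finset.range k, ∀ j₃ ∈ Finset.range k,
      P.mesh j₁ ^ a₁ * P.mesh j₂ ^ a₂ * P.mesh j₃ ^ a₃ * (P.mesh (max j₁ (max j₂ j₃)) ^ P.d)⁻¹
        ≤ P.mesh j₁ ^ (a₁ * s) * P.mesh j₂ ^ (a₂ * s) * P.mesh j₃ ^ (a₃ * s) := by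
    intro j₁ _ j₂ _ j₃ _
    have htop := rpow_top_le_prod3 (P := P) (jm := max j₁ (max j₂ j₃)) (le_max_left _ _)
      ((le_max_left _ _).trans (le_max_right _ _)) ((le_max_right _ _).trans (le_max_right _ _))
      (hθi ha₁) (hθi ha₂) (hθi ha₃) hθ
    have h0 : 0 ≤ P.mesh j₁ ^ a₁ * P.mesh j₂ ^ a₂ * P.mesh j₃ ^ a₃ :=
      mul_nonneg (mul_nonneg (Real.rpow_nonneg (hm _).le _) (Real.rpow_nonneg (hm _).le _))
        (Real.rpow_nonneg (hm _).le _)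
    calc P.mesh j₁ ^ a₁ * P.mesh j₂ ^ a₂ * P.mesh j₃ ^ a₃ * (P.mesh (max j₁ (max j₂ j₃)) ^ P.d)⁻¹
        ≤ P.mesh j₁ ^ a₁ * P.mesh j₂ ^ a₂ * P.mesh j₃ ^ a₃ *
            (P.mesh j₁ ^ (-((P.d : ℝ) * (a₁ / A))) * P.mesh j₂ ^ (-((P.d : ℝ) * (a₂ / A))) *
              P.mesh j₃ ^ (-((P.d : ℝ) * (a₃ / A)))) := mul_le_mul_of_nonneg_left htop h0
      _ = (P.mesh j₁ ^ a₁ * P.mesh j₁ ^ (-((P.d : ℝ) * (a₁ / A)))) *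
            (P.mesh j₂ ^ a₂ * P.mesh j₂ ^ (-((P.d : ℝ) * (a₂ / A)))) *
            (P.mesh j₃ ^ a₃ * P.mesh j₃ ^ (-((P.d : ℝ) * (a₃ / A)))) := by ring
      _ = P.mesh j₁ ^ (a₁ * s) * P.mesh j₂ ^ (a₂ * s) * P.mesh j₃ ^ (a₃ * s) := by
            rw [mesh_rpow_add, mesh_rpow_add, mesh_rpow_add, hexp, hexp, hexp]
  -- the factorized sum
  have hgeo : ∀ {a : ℝ}, 0 < a →
      ∑ j ∈ Finset.range k, P.mesh j ^ (a * s) ≤ P.mesh k ^ (a * s) / ((P.L : ℝ) ^ (a * s) - 1) :=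
    fun {a} ha => sum_mesh_rpow_le (mul_pos ha hs0) hL k
  have hgeo0 : ∀ {a : ℝ}, 0 ≤ ∑ j ∈ Finset.range k, P.mesh j ^ (a * s) :=
    fun {a} => Finset.sum_nonneg fun j _ => Real.rpow_nonneg (hm j).le _
  have hfact : ∑ j₁ ∈ Finset.range k, ∑ j₂ ∈ Finset.range k, ∑ j₃ ∈ Finset.range k,
        P.mesh j₁ ^ (a₁ * s) * P.mesh j₂ ^ (a₂ * s) * P.mesh j₃ ^ (a₃ * s)
      = (∑ j₁ ∈ Finset.range k, P.mesh j₁ ^ (a₁ * s)) * (∑ j₂ ∈ Finset.range k, P.mesh j₂ ^ (a₂ * s)) *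
          (∑ j₃ ∈ Finset.range k, P.mesh j₃ ^ (a₃ * s)) := by
    symm
    rw [mul_assoc, Finset.sum_mul]
    refine Finset.sum_congr rfl fun j₁ _ => ?_
    rw [Finset.sum_mul, Finset.mul_sum]
    refine Finset.sum_congr rfl fun j₂ _ => ?_
    rw [Finset.mul_sum, Finset.mul_sum]
    refine Finset.sum_congr rfl fun j₃ _ => ?_
    ring
  calc ∑ j₁ ∈ Finset.range k, ∑ j₂ ∈ Finset.range k, ∑ j₃ ∈ Finset.range k,
        P.mesh j₁ ^ a₁ * P.mesh j₂ ^ a₂ * P.mesh j₃ ^ a₃ * (P.mesh (max j₁ (max j₂ j₃)) ^ P.d)⁻¹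
      ≤ ∑ j₁ ∈ Finset.range k, ∑ j₂ ∈ Finset.range k, ∑ j₃ ∈ Finset.range k,
          P.mesh j₁ ^ (a₁ * s) * P.mesh j₂ ^ (a₂ * s) * P.mesh j₃ ^ (a₃ * s) :=
        Finset.sum_le_sum fun j₁ h₁ => Finset.sum_le_sum fun j₂ h₂ => Finset.sum_le_sum fun j₃ h₃ =>
          hterm j₁ h₁ j₂ h₂ j₃ h₃
    _ = (∑ j₁ ∈ Finset.range k, P.mesh j₁ ^ (a₁ * s)) * (∑ j₂ ∈ Finset.range k, P.mesh j₂ ^ (a₂ * s)) *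
          (∑ j₃ ∈ Finset.range k, P.mesh j₃ ^ (a₃ * s)) := hfact
    _ ≤ (P.mesh k ^ (a₁ * s) / ((P.L : ℝ) ^ (a₁ * s) - 1)) * (P.mesh k ^ (a₂ * s) / ((P.L : ℝ) ^ (a₂ * s) - 1)) *
          (P.mesh k ^ (a₃ * s) / ((P.L : ℝ) ^ (a₃ * s) - 1)) := by
        refine mul_le_mul (mul_le_mul (hgeo ha₁) (hgeo ha₂) hgeo0 ?_) (hgeo ha₃) hgeo0 ?_
        · exact le_trans hgeo0 (hgeo ha₁)
        · exact mul_nonneg (le_trans hgeo0 (hgeo ha₁)) (le_trans hgeo0 (hgeo ha₂))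
    _ = (1 / ((P.L : ℝ) ^ (a₁ * s) - 1)) * (1 / ((P.L : ℝ) ^ (a₂ * s) - 1)) * (1 / ((P.L : ℝ) ^ (a₃ * s) - 1)) *
          (P.mesh k ^ (a₁ * s) * P.mesh k ^ (a₂ * s) * P.mesh k ^ (a₃ * s)) := by ring
    _ = _ := by
        rw [mesh_rpow_add, mesh_rpow_add]
        congr 1
        congr 1
        rw [hs]; field_simp; ring

end Chains

/-! ## §6 (v1.1) The weighted `ℓ²`-column lemma (exponential weight at the top scale, for the near/far splits of the chains) -/

section WeightedColumns

variable {k : ℕ}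

/-- **THE WEIGHTED `ℓ²`-COLUMN LEMMA** (`d ≤ 3`): with the weight `e^{2δ′|y−x|/L^k}`, `δ′ ≤ δ/2`, a column with the (2.10) value profile at
every scale piece `j < k` still has `Σ_y ε^d e^{2δ′|y−x|/L^k}(Σ_{j<k}|K_j(y)|)² ≤ c²·N(8d/δ)^d·(L^{(4−d)/2} − 1)^{−2}·(L^kε)^{4−d}` — half of the
decay rate of every piece absorbs the top-scale weight (`L^j ≤ L^k`), and `sq_col_le` applies at rate `δ/2`; the exponential tails of the outer
propagator columns of the chains of (1.16). [cite: Balaban1983Higgs3, (1.16) p.414, (2.6) p.424, (2.10) p.426] -/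
theorem sq_col_weighted_le (hL : 1 < P.L) (hd3 : P.d ≤ 3) {c δ δ' : ℝ} (hc : 0 ≤ c) (hδ : 0 < δ) (hδ2 : δ ≤ 1 / 2)
    (hδ'0 : 0 ≤ δ') (hδ' : δ' ≤ δ / 2)
    (x : HiggsLattice.Site P 0) (i₀ : Ix N) (K : ℕ → HiggsLattice.Site P 0 → ℝ)
    (hK : ∀ j, j < k → ∀ y, |K j y| ≤ c * P.mesh j ^ ((2 : ℝ) - (P.d : ℝ)) *
      Real.exp (-(δ * (P.mesh j)⁻¹ * (P.mesh 0 * (HiggsLattice.Site.tdist y x : ℝ))))) :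
    ∑ y, P.mesh 0 ^ P.d * (Real.exp (2 * (δ' / (P.L : ℝ) ^ k * (HiggsLattice.Site.tdist y x : ℝ))) *
        (∑ j ∈ Finset.range k, |K j y|) ^ 2)
      ≤ c ^ 2 * ((nCol N : ℝ) * (4 * P.d / (δ / 2)) ^ P.d) / ((P.L : ℝ) ^ (((4 : ℝ) - (P.d : ℝ)) / 2) - 1) ^ 2 *
          P.mesh k ^ ((4 : ℝ) - (P.d : ℝ)) := by
  have hL1 : (1 : ℝ) ≤ (P.L : ℝ) := by exact_mod_cast hL.le
  -- the weighted columns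
  set W : HiggsLattice.Site P 0 → ℝ := fun y => Real.exp (δ' / (P.L : ℝ) ^ k * (HiggsLattice.Site.tdist y x : ℝ)) with hW
  have hWpos : ∀ y, 0 < W y := fun y => Real.exp_pos _
  set K' : ℕ → HiggsLattice.Site P 0 → ℝ := fun j y => W y * K j y with hK'
  -- they obey the (2.10) profile at rate δ/2
  have hK'b : ∀ j, j < k → ∀ y, |K' j y| ≤ c * P.mesh j ^ ((2 : ℝ) - (P.d : ℝ)) *
      Real.exp (-(δ / 2 * (P.mesh j)⁻¹ * (P.mesh 0 * (HiggsLattice.Site.tdist y x : ℝ)))) := by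
    intro j hj y
    have h := hK j hj y
    simp only [hK']
    rw [abs_mul, abs_of_pos (hWpos y)]
    have hA0 : 0 ≤ c * P.mesh j ^ ((2 : ℝ) - (P.d : ℝ)) := mul_nonneg hc (Real.rpow_nonneg (P.mesh_pos j).le _)
    -- rates in lattice units
    rw [rate_eq] at h
    rw [rate_eq]
    have ht0 : (0 : ℝ) ≤ (HiggsLattice.Site.tdist y x : ℝ) := Nat.cast_nonneg _
    -- `δ′/L^k ≤ (δ/2)/L^j`
    have hjk : (P.L : ℝ) ^ j ≤ (P.L : ℝ) ^ k := pow_le_pow_right₀ hL1 hj.le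
    have hLj : (0 : ℝ) < (P.L : ℝ) ^ j := by positivity
    have hrate : δ' / (P.L : ℝ) ^ k ≤ δ / 2 / (P.L : ℝ) ^ j :=
      (div_le_div_of_nonneg_left hδ'0 hLj hjk).trans (div_le_div_of_nonneg_right hδ' hLj.le)
    calc W y * |K j y| ≤ W y * (c * P.mesh j ^ ((2 : ℝ) - (P.d : ℝ)) *
          Real.exp (-(δ / (P.L : ℝ) ^ j * (HiggsLattice.Site.tdist y x : ℝ)))) :=
          mul_le_mul_of_nonneg_left h (hWpos y).le
      _ = c * P.mesh j ^ ((2 : ℝ) - (P.d : ℝ)) *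
          (W y * Real.exp (-(δ / (P.L : ℝ) ^ j * (HiggsLattice.Site.tdist y x : ℝ)))) := by ring
      _ ≤ c * P.mesh j ^ ((2 : ℝ) - (P.d : ℝ)) *
          Real.exp (-(δ / 2 / (P.L : ℝ) ^ j * (HiggsLattice.Site.tdist y x : ℝ))) := by
          refine mul_le_mul_of_nonneg_left ?_ hA0
          rw [hW, ← Real.exp_add]
          apply Real.exp_le_exp.mpr
          have : δ / 2 / (P.L : ℝ) ^ j = δ / (P.L : ℝ) ^ j - δ / 2 / (P.L : ℝ) ^ j := by ring
          nlinarith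
  have hδh : 0 < δ / 2 := by linarith
  have hδh2 : δ / 2 ≤ 1 / 2 := by linarith
  have h := sq_col_le (P := P) (N := N) hL hd3 hc hδh hδh2 x i₀ K' hK'b
  -- unfold the weighted columns in the conclusion
  refine le_trans (le_of_eq (Finset.sum_congr rfl fun y _ => ?_)) h
  simp only [hK']
  have hsum : ∑ j ∈ Finset.range k, |W y * K j y| = W y * ∑ j ∈ Finset.range k, |K j y| := by
    rw [Finset.mul_sum]
    exact Finset.sum_congr rfl fun j _ => by rw [abs_mul, abs_of_pos (hWpos y)]
  rw [hsum, mul_pow, hW, ← Real.exp_nat_mul]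
  push_cast
  ring

end WeightedColumns

/-! ## §7 (v1.2) The three-kernel chain across all scales: the order count `Σa_i > d` in closed form -/

section Chain3

variable {k : ℕ}

/-- Three (2.10)-profiles on SITES at scales `j₁, j₂, j₃` convolved `x → u → v → x′` cost the volumes of the two finer scales and keep a
quarter of the decay of the coarsest (`conv3_scales_le` on the site sums, rates `δ(L^jε)^{−1}·ε|·| = (δ/L^j)|·|`).
[cite: Balaban1983Higgs3, (2.6) p.424, (2.10) p.426] [cite: Balaban1983RegularityDecay, Sect. 5 Theorem p.594] -/
theorem conv3_sites_le {δ : ℝ} (hδ : 0 < δ) (hδ1 : δ ≤ 1) (j₁ j₂ j₃ : ℕ) (x x' : HiggsLattice.Site P 0) (i₀ : Ix N) :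
    ∑ u : HiggsLattice.Site P 0, ∑ v : HiggsLattice.Site P 0,
        Real.exp (-(δ * (P.mesh j₁)⁻¹ * (P.mesh 0 * (HiggsLattice.Site.tdist x u : ℝ)))) *
          Real.exp (-(δ * (P.mesh j₂)⁻¹ * (P.mesh 0 * (HiggsLattice.Site.tdist u v : ℝ)))) *
          Real.exp (-(δ * (P.mesh j₃)⁻¹ * (P.mesh 0 * (HiggsLattice.Site.tdist v x' : ℝ))))
      ≤ ((nCol N : ℝ) * (8 * P.d / δ) ^ P.d) * ((nCol N : ℝ) * (16 * P.d / δ) ^ P.d) *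
          ((P.L : ℝ) ^ (j₁ + j₂ + j₃ - max j₁ (max j₂ j₃))) ^ P.d *
          Real.exp (-(δ / (P.L : ℝ) ^ (max j₁ (max j₂ j₃)) / 4 * (HiggsLattice.Site.tdist x x' : ℝ))) := by
  simp only [rate_eq]
  calc ∑ u : HiggsLattice.Site P 0, ∑ v : HiggsLattice.Site P 0,
        Real.exp (-(δ / (P.L : ℝ) ^ j₁ * (HiggsLattice.Site.tdist x u : ℝ))) *
          Real.exp (-(δ / (P.L : ℝ) ^ j₂ * (HiggsLattice.Site.tdist u v : ℝ))) *
          Real.exp (-(δ / (P.L : ℝ) ^ j₃ * (HiggsLattice.Site.tdist v x' : ℝ)))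
      ≤ ∑ s : HiggsLattice.Site P 0 × Ix N, ∑ v : HiggsLattice.Site P 0,
          Real.exp (-(δ / (P.L : ℝ) ^ j₁ * (HiggsLattice.Site.tdist x s.1 : ℝ))) *
            Real.exp (-(δ / (P.L : ℝ) ^ j₂ * (HiggsLattice.Site.tdist s.1 v : ℝ))) *
            Real.exp (-(δ / (P.L : ℝ) ^ j₃ * (HiggsLattice.Site.tdist v x' : ℝ))) :=
        sum_site_le_sum_idx _ (fun u => Finset.sum_nonneg fun v _ => by positivity) i₀
    _ ≤ ∑ s : HiggsLattice.Site P 0 × Ix N, ∑ t : HiggsLattice.Site P 0 × Ix N,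
          Real.exp (-(δ / (P.L : ℝ) ^ j₁ * (HiggsLattice.Site.tdist x s.1 : ℝ))) *
            Real.exp (-(δ / (P.L : ℝ) ^ j₂ * (HiggsLattice.Site.tdist s.1 t.1 : ℝ))) *
            Real.exp (-(δ / (P.L : ℝ) ^ j₃ * (HiggsLattice.Site.tdist t.1 x' : ℝ))) :=
        Finset.sum_le_sum fun s _ => sum_site_le_sum_idx _ (fun v => by positivity) i₀
    _ ≤ _ := conv3_scales_le hδ hδ1 j₁ j₂ j₃ x x' i₀

/-- The scale algebra of a chain: `Π_i(L^{j_i}ε)^{a_i−d} · (L^{j₁+j₂+j₃−j_max})^d = Π_i(L^{j_i}ε)^{a_i} · ((L^{j_max}ε)^d)^{−1} · (ε^d)^{−2}`.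
[cite: Balaban1983Higgs3, (2.6) p.424, (2.10) p.426] -/
theorem chain3_scale_algebra (j₁ j₂ j₃ : ℕ) {m : ℕ} (hm : m ≤ j₁ + j₂ + j₃) (a₁ a₂ a₃ : ℝ) :
    P.mesh j₁ ^ (a₁ - (P.d : ℝ)) * P.mesh j₂ ^ (a₂ - (P.d : ℝ)) * P.mesh j₃ ^ (a₃ - (P.d : ℝ)) *
        ((P.L : ℝ) ^ (j₁ + j₂ + j₃ - m)) ^ P.d
      = P.mesh j₁ ^ a₁ * P.mesh j₂ ^ a₂ * P.mesh j₃ ^ a₃ * (P.mesh m ^ P.d)⁻¹ * ((P.mesh 0 ^ P.d)⁻¹) ^ 2 := by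
  have hL0 : (0 : ℝ) < (P.L : ℝ) := by have := P.hL; positivity
  have hm0 : 0 < P.mesh 0 := P.mesh_pos 0
  have hsub : ∀ (j : ℕ) (a : ℝ), P.mesh j ^ (a - (P.d : ℝ)) = P.mesh j ^ a * (((P.L : ℝ) ^ j) ^ P.d * P.mesh 0 ^ P.d)⁻¹ := by
    intro j a
    rw [Real.rpow_sub (P.mesh_pos j), Real.rpow_natCast, div_eq_mul_inv,
      show P.mesh j = (P.L : ℝ) ^ j * P.mesh 0 by simp [HiggsLattice.Params.mesh], mul_pow]
  have hmesh : P.mesh m ^ P.d = ((P.L : ℝ) ^ m) ^ P.d * P.mesh 0 ^ P.d := by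
    rw [show P.mesh m = (P.L : ℝ) ^ m * P.mesh 0 by simp [HiggsLattice.Params.mesh], mul_pow]
  have hpow : ((P.L : ℝ) ^ (j₁ + j₂ + j₃ - m)) ^ P.d * ((P.L : ℝ) ^ m) ^ P.d
      = ((P.L : ℝ) ^ j₁) ^ P.d * ((P.L : ℝ) ^ j₂) ^ P.d * ((P.L : ℝ) ^ j₃) ^ P.d := by
    rw [← mul_pow, ← pow_add, Nat.sub_add_cancel hm, pow_add, pow_add, mul_pow, mul_pow]
  rw [hsub, hsub, hsub, hmesh]
  have h1 : ((P.L : ℝ) ^ j₁) ^ P.d ≠ 0 := by positivity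
  have h2 : ((P.L : ℝ) ^ j₂) ^ P.d ≠ 0 := by positivity
  have h3 : ((P.L : ℝ) ^ j₃) ^ P.d ≠ 0 := by positivity
  have h4 : ((P.L : ℝ) ^ m) ^ P.d ≠ 0 := by positivity
  have h5 : P.mesh 0 ^ P.d ≠ 0 := by positivity
  field_simp
  calc P.mesh j₁ ^ a₁ * P.mesh j₂ ^ a₂ * P.mesh j₃ ^ a₃ * ((P.L : ℝ) ^ (j₁ + j₂ + j₃ - m)) ^ P.d * ((P.L : ℝ) ^ m) ^ P.d
      = P.mesh j₁ ^ a₁ * P.mesh j₂ ^ a₂ * P.mesh j₃ ^ a₃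
          * (((P.L : ℝ) ^ (j₁ + j₂ + j₃ - m)) ^ P.d * ((P.L : ℝ) ^ m) ^ P.d) := by ring
    _ = _ := by rw [hpow]; ring

/-- **THE THREE-KERNEL CHAIN BOUND.**  If three nonnegative kernels on `T_ε` are bounded by the (2.10)-profiles summed over the scales
`j < k` with exponents `a₁, a₂, a₃ > 0`, `F_i ≤ Σ_{j<k} c_i(L^jε)^{a_i−d}e^{−δ(L^jε)^{−1}ε|·|}`, and `a₁ + a₂ + a₃ > d`, then the chain
`Σ_uΣ_v F₁(x,u)F₂(u,v)F₃(v,x′)` is bounded by `c₁c₂c₃·K(N,d,δ)·Π_i(L^{a_i(1−d/Σa)} − 1)^{−1}·(ε^d)^{−2}·(L^kε)^{a₁+a₂+a₃−d}·e^{−(δ/4)(L^kε)^{−1}ε|x−x′|}`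
UNIFORMLY IN `k` — the order count behind *"for n, n′ sufficiently large, a kernel of the operator (1.16) is a sufficiently regular
function"* (each undifferentiated propagator factor has `a = 2`, each covariant derivative lowers `a` by one; `conv3_sites_le` +
`chain3_scale_algebra` + `sum3_scales_le`). [cite: Balaban1983Higgs3, (1.16) p.414, (2.6) p.424, (2.10) p.426] -/
theorem chain3_le (hL : 1 < P.L) {δ : ℝ} (hδ : 0 < δ) (hδ1 : δ ≤ 1) {a₁ a₂ a₃ : ℝ} (ha₁ : 0 < a₁) (ha₂ : 0 < a₂) (ha₃ : 0 < a₃)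
    (hsum : (P.d : ℝ) < a₁ + a₂ + a₃) {c₁ c₂ c₃ : ℝ} (hc₁ : 0 ≤ c₁) (hc₂ : 0 ≤ c₂) (hc₃ : 0 ≤ c₃) (i₀ : Ix N)
    (x x' : HiggsLattice.Site P 0) (F₁ F₃ : HiggsLattice.Site P 0 → ℝ) (F₂ : HiggsLattice.Site P 0 → HiggsLattice.Site P 0 → ℝ)
    (hF₁0 : ∀ u, 0 ≤ F₁ u) (hF₂0 : ∀ u v, 0 ≤ F₂ u v) (hF₃0 : ∀ v, 0 ≤ F₃ v)
    (hF₁ : ∀ u, F₁ u ≤ ∑ j ∈ Finset.range k, c₁ * P.mesh j ^ (a₁ - (P.d : ℝ)) *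
      Real.exp (-(δ * (P.mesh j)⁻¹ * (P.mesh 0 * (HiggsLattice.Site.tdist x u : ℝ)))))
    (hF₂ : ∀ u v, F₂ u v ≤ ∑ j ∈ Finset.range k, c₂ * P.mesh j ^ (a₂ - (P.d : ℝ)) *
      Real.exp (-(δ * (P.mesh j)⁻¹ * (P.mesh 0 * (HiggsLattice.Site.tdist u v : ℝ)))))
    (hF₃ : ∀ v, F₃ v ≤ ∑ j ∈ Finset.range k, c₃ * P.mesh j ^ (a₃ - (P.d : ℝ)) *
      Real.exp (-(δ * (P.mesh j)⁻¹ * (P.mesh 0 * (HiggsLattice.Site.tdist v x' : ℝ))))) :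
    ∑ u : HiggsLattice.Site P 0, ∑ v : HiggsLattice.Site P 0, F₁ u * F₂ u v * F₃ v
      ≤ c₁ * c₂ * c₃ * (((nCol N : ℝ) * (8 * P.d / δ) ^ P.d) * ((nCol N : ℝ) * (16 * P.d / δ) ^ P.d)) *
          ((1 / ((P.L : ℝ) ^ (a₁ * (1 - (P.d : ℝ) / (a₁ + a₂ + a₃))) - 1)) *
            (1 / ((P.L : ℝ) ^ (a₂ * (1 - (P.d : ℝ) / (a₁ + a₂ + a₃))) - 1)) *
            (1 / ((P.L : ℝ) ^ (a₃ * (1 - (P.d : ℝ) / (a₁ + a₂ + a₃))) - 1))) *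
          ((P.mesh 0 ^ P.d)⁻¹) ^ 2 * P.mesh k ^ (a₁ + a₂ + a₃ - (P.d : ℝ)) *
          Real.exp (-(δ / 4 * (P.mesh k)⁻¹ * (P.mesh 0 * (HiggsLattice.Site.tdist x x' : ℝ)))) := by
  have hL1 : (1 : ℝ) ≤ (P.L : ℝ) := by exact_mod_cast P.hL
  have hL0 : (0 : ℝ) < (P.L : ℝ) := by positivity
  have hm0 : 0 < P.mesh 0 := P.mesh_pos 0
  -- abbreviations for the profiles
  set e : ℕ → HiggsLattice.Site P 0 → HiggsLattice.Site P 0 → ℝ :=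
    fun j u v => Real.exp (-(δ * (P.mesh j)⁻¹ * (P.mesh 0 * (HiggsLattice.Site.tdist u v : ℝ)))) with he
  have he0 : ∀ j u v, 0 ≤ e j u v := fun j u v => Real.exp_nonneg _
  set K : ℝ := ((nCol N : ℝ) * (8 * P.d / δ) ^ P.d) * ((nCol N : ℝ) * (16 * P.d / δ) ^ P.d) with hK
  have hK0 : 0 ≤ K := by
    have h8 : 0 ≤ (8 * (P.d : ℝ) / δ) ^ P.d := pow_nonneg (by positivity) _
    have h16 : 0 ≤ (16 * (P.d : ℝ) / δ) ^ P.d := pow_nonneg (by positivity) _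
    rw [hK]; positivity
  set Etop : ℝ := Real.exp (-(δ / 4 * (P.mesh k)⁻¹ * (P.mesh 0 * (HiggsLattice.Site.tdist x x' : ℝ)))) with hEtop
  -- Step 1: expand the three scale sums and exchange with the site sums
  have step1 : ∑ u : HiggsLattice.Site P 0, ∑ v : HiggsLattice.Site P 0, F₁ u * F₂ u v * F₃ v
      ≤ ∑ j₁ ∈ Finset.range k, ∑ j₂ ∈ Finset.range k, ∑ j₃ ∈ Finset.range k,
          c₁ * c₂ * c₃ * (P.mesh j₁ ^ (a₁ - (P.d : ℝ)) * P.mesh j₂ ^ (a₂ - (P.d : ℝ)) * P.mesh j₃ ^ (a₃ - (P.d : ℝ))) *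
            ∑ u : HiggsLattice.Site P 0, ∑ v : HiggsLattice.Site P 0, e j₁ x u * e j₂ u v * e j₃ v x' := by
    have hprod : ∀ u v, F₁ u * F₂ u v * F₃ v
        ≤ (∑ j ∈ Finset.range k, c₁ * P.mesh j ^ (a₁ - (P.d : ℝ)) * e j x u) *
          (∑ j ∈ Finset.range k, c₂ * P.mesh j ^ (a₂ - (P.d : ℝ)) * e j u v) *
          (∑ j ∈ Finset.range k, c₃ * P.mesh j ^ (a₃ - (P.d : ℝ)) * e j v x') := by
      intro u v
      have h1 := hF₁ u; have h2 := hF₂ u v; have h3 := hF₃ v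
      have h10 := hF₁0 u; have h20 := hF₂0 u v; have h30 := hF₃0 v
      exact mul_le_mul (mul_le_mul h1 h2 h20 (h10.trans h1)) h3 h30 (mul_nonneg (h10.trans h1) (h20.trans h2))
    calc ∑ u : HiggsLattice.Site P 0, ∑ v : HiggsLattice.Site P 0, F₁ u * F₂ u v * F₃ v
        ≤ ∑ u : HiggsLattice.Site P 0, ∑ v : HiggsLattice.Site P 0,
            (∑ j ∈ Finset.range k, c₁ * P.mesh j ^ (a₁ - (P.d : ℝ)) * e j x u) *
            (∑ j ∈ Finset.range k, c₂ * P.mesh j ^ (a₂ - (P.d : ℝ)) * e j u v) *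
            (∑ j ∈ Finset.range k, c₃ * P.mesh j ^ (a₃ - (P.d : ℝ)) * e j v x') :=
          Finset.sum_le_sum fun u _ => Finset.sum_le_sum fun v _ => hprod u v
      _ = _ := by
          -- expand the products of sums and exchange the order of summation
          have hexp : ∀ u v : HiggsLattice.Site P 0,
              (∑ j ∈ Finset.range k, c₁ * P.mesh j ^ (a₁ - (P.d : ℝ)) * e j x u) *
                (∑ j ∈ Finset.range k, c₂ * P.mesh j ^ (a₂ - (P.d : ℝ)) * e j u v) *
                (∑ j ∈ Finset.range k, c₃ * P.mesh j ^ (a₃ - (P.d : ℝ)) * e j v x')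
              = ∑ j₁ ∈ Finset.range k, ∑ j₂ ∈ Finset.range k, ∑ j₃ ∈ Finset.range k,
                  c₁ * c₂ * c₃ * (P.mesh j₁ ^ (a₁ - (P.d : ℝ)) * P.mesh j₂ ^ (a₂ - (P.d : ℝ)) * P.mesh j₃ ^ (a₃ - (P.d : ℝ))) *
                    (e j₁ x u * e j₂ u v * e j₃ v x') := by
            intro u v
            rw [Finset.sum_mul_sum, Finset.sum_mul]
            refine Finset.sum_congr rfl fun j₁ _ => ?_
            rw [Finset.sum_mul]
            refine Finset.sum_congr rfl fun j₂ _ => ?_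
            rw [Finset.mul_sum]
            refine Finset.sum_congr rfl fun j₃ _ => ?_
            ring
          simp_rw [hexp]
          -- Σ_u Σ_v Σ_{j₁} Σ_{j₂} Σ_{j₃} → Σ_{j₁} Σ_{j₂} Σ_{j₃} Σ_u Σ_v
          calc ∑ u : HiggsLattice.Site P 0, ∑ v : HiggsLattice.Site P 0,
                ∑ j₁ ∈ Finset.range k, ∑ j₂ ∈ Finset.range k, ∑ j₃ ∈ Finset.range k,
                  c₁ * c₂ * c₃ * (P.mesh j₁ ^ (a₁ - (P.d : ℝ)) * P.mesh j₂ ^ (a₂ - (P.d : ℝ)) * P.mesh j₃ ^ (a₃ - (P.d : ℝ))) *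
                    (e j₁ x u * e j₂ u v * e j₃ v x')
              = ∑ u : HiggsLattice.Site P 0, ∑ j₁ ∈ Finset.range k, ∑ v : HiggsLattice.Site P 0,
                  ∑ j₂ ∈ Finset.range k, ∑ j₃ ∈ Finset.range k,
                  c₁ * c₂ * c₃ * (P.mesh j₁ ^ (a₁ - (P.d : ℝ)) * P.mesh j₂ ^ (a₂ - (P.d : ℝ)) * P.mesh j₃ ^ (a₃ - (P.d : ℝ))) *
                    (e j₁ x u * e j₂ u v * e j₃ v x') :=
                Finset.sum_congr rfl fun u _ => Finset.sum_comm
            _ = ∑ j₁ ∈ Finset.range k, ∑ u : HiggsLattice.Site P 0, ∑ v : HiggsLattice.Site P 0,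
                  ∑ j₂ ∈ Finset.range k, ∑ j₃ ∈ Finset.range k,
                  c₁ * c₂ * c₃ * (P.mesh j₁ ^ (a₁ - (P.d : ℝ)) * P.mesh j₂ ^ (a₂ - (P.d : ℝ)) * P.mesh j₃ ^ (a₃ - (P.d : ℝ))) *
                    (e j₁ x u * e j₂ u v * e j₃ v x') := Finset.sum_comm
            _ = ∑ j₁ ∈ Finset.range k, ∑ u : HiggsLattice.Site P 0, ∑ j₂ ∈ Finset.range k,
                  ∑ v : HiggsLattice.Site P 0, ∑ j₃ ∈ Finset.range k,
                  c₁ * c₂ * c₃ * (P.mesh j₁ ^ (a₁ - (P.d : ℝ)) * P.mesh j₂ ^ (a₂ - (P.d : ℝ)) * P.mesh j₃ ^ (a₃ - (P.d : ℝ))) *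
                    (e j₁ x u * e j₂ u v * e j₃ v x') :=
                Finset.sum_congr rfl fun j₁ _ => Finset.sum_congr rfl fun u _ => Finset.sum_comm
            _ = ∑ j₁ ∈ Finset.range k, ∑ j₂ ∈ Finset.range k, ∑ u : HiggsLattice.Site P 0,
                  ∑ v : HiggsLattice.Site P 0, ∑ j₃ ∈ Finset.range k,
                  c₁ * c₂ * c₃ * (P.mesh j₁ ^ (a₁ - (P.d : ℝ)) * P.mesh j₂ ^ (a₂ - (P.d : ℝ)) * P.mesh j₃ ^ (a₃ - (P.d : ℝ))) *
                    (e j₁ x u * e j₂ u v * e j₃ v x') :=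
                Finset.sum_congr rfl fun j₁ _ => Finset.sum_comm
            _ = ∑ j₁ ∈ Finset.range k, ∑ j₂ ∈ Finset.range k, ∑ u : HiggsLattice.Site P 0,
                  ∑ j₃ ∈ Finset.range k, ∑ v : HiggsLattice.Site P 0,
                  c₁ * c₂ * c₃ * (P.mesh j₁ ^ (a₁ - (P.d : ℝ)) * P.mesh j₂ ^ (a₂ - (P.d : ℝ)) * P.mesh j₃ ^ (a₃ - (P.d : ℝ))) *
                    (e j₁ x u * e j₂ u v * e j₃ v x') :=
                Finset.sum_congr rfl fun j₁ _ => Finset.sum_congr rfl fun j₂ _ =>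
                  Finset.sum_congr rfl fun u _ => Finset.sum_comm
            _ = ∑ j₁ ∈ Finset.range k, ∑ j₂ ∈ Finset.range k, ∑ j₃ ∈ Finset.range k,
                  ∑ u : HiggsLattice.Site P 0, ∑ v : HiggsLattice.Site P 0,
                  c₁ * c₂ * c₃ * (P.mesh j₁ ^ (a₁ - (P.d : ℝ)) * P.mesh j₂ ^ (a₂ - (P.d : ℝ)) * P.mesh j₃ ^ (a₃ - (P.d : ℝ))) *
                    (e j₁ x u * e j₂ u v * e j₃ v x') :=
                Finset.sum_congr rfl fun j₁ _ => Finset.sum_congr rfl fun j₂ _ => Finset.sum_comm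
            _ = _ := by simp_rw [Finset.mul_sum]
  -- Step 2: each scale triple
  have step2 : ∀ j₁ j₂ j₃ : ℕ, j₁ < k → j₂ < k → j₃ < k →
      c₁ * c₂ * c₃ * (P.mesh j₁ ^ (a₁ - (P.d : ℝ)) * P.mesh j₂ ^ (a₂ - (P.d : ℝ)) * P.mesh j₃ ^ (a₃ - (P.d : ℝ))) *
          ∑ u : HiggsLattice.Site P 0, ∑ v : HiggsLattice.Site P 0, e j₁ x u * e j₂ u v * e j₃ v x'
        ≤ c₁ * c₂ * c₃ * K * ((P.mesh 0 ^ P.d)⁻¹) ^ 2 * Etop *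
          (P.mesh j₁ ^ a₁ * P.mesh j₂ ^ a₂ * P.mesh j₃ ^ a₃ * (P.mesh (max j₁ (max j₂ j₃)) ^ P.d)⁻¹) := by
    intro j₁ j₂ j₃ hj₁ hj₂ hj₃
    have hconv := conv3_sites_le (P := P) hδ hδ1 j₁ j₂ j₃ x x' i₀
    have hmax : max j₁ (max j₂ j₃) ≤ j₁ + j₂ + j₃ := by omega
    have hmaxk : max j₁ (max j₂ j₃) < k := by omega
    -- the decay of the coarsest scale is at least the top-scale decay
    have hexp_top : Real.exp (-(δ / (P.L : ℝ) ^ (max j₁ (max j₂ j₃)) / 4 * (HiggsLattice.Site.tdist x x' : ℝ))) ≤ Etop := by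
      rw [hEtop]
      apply Real.exp_le_exp.mpr
      have ht : (0 : ℝ) ≤ (HiggsLattice.Site.tdist x x' : ℝ) := Nat.cast_nonneg _
      have hmk : δ / 4 * (P.mesh k)⁻¹ * (P.mesh 0 * (HiggsLattice.Site.tdist x x' : ℝ))
          = δ / (P.L : ℝ) ^ k / 4 * (HiggsLattice.Site.tdist x x' : ℝ) := by
        rw [show P.mesh k = (P.L : ℝ) ^ k * P.mesh 0 by simp [HiggsLattice.Params.mesh]]
        field_simp
      rw [hmk, neg_le_neg_iff]
      have hpow : (P.L : ℝ) ^ (max j₁ (max j₂ j₃)) ≤ (P.L : ℝ) ^ k := pow_le_pow_right₀ hL1 hmaxk.le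
      have hLm : (0 : ℝ) < (P.L : ℝ) ^ (max j₁ (max j₂ j₃)) := by positivity
      have h1 : δ / (P.L : ℝ) ^ k ≤ δ / (P.L : ℝ) ^ (max j₁ (max j₂ j₃)) := div_le_div_of_nonneg_left hδ.le hLm hpow
      nlinarith
    have hℓ : 0 ≤ c₁ * c₂ * c₃ * (P.mesh j₁ ^ (a₁ - (P.d : ℝ)) * P.mesh j₂ ^ (a₂ - (P.d : ℝ)) * P.mesh j₃ ^ (a₃ - (P.d : ℝ))) := by
      have := Real.rpow_nonneg (P.mesh_pos j₁).le (a₁ - (P.d : ℝ))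
      have := Real.rpow_nonneg (P.mesh_pos j₂).le (a₂ - (P.d : ℝ))
      have := Real.rpow_nonneg (P.mesh_pos j₃).le (a₃ - (P.d : ℝ))
      positivity
    calc c₁ * c₂ * c₃ * (P.mesh j₁ ^ (a₁ - (P.d : ℝ)) * P.mesh j₂ ^ (a₂ - (P.d : ℝ)) * P.mesh j₃ ^ (a₃ - (P.d : ℝ))) *
          ∑ u : HiggsLattice.Site P 0, ∑ v : HiggsLattice.Site P 0, e j₁ x u * e j₂ u v * e j₃ v x'
        ≤ c₁ * c₂ * c₃ * (P.mesh j₁ ^ (a₁ - (P.d : ℝ)) * P.mesh j₂ ^ (a₂ - (P.d : ℝ)) * P.mesh j₃ ^ (a₃ - (P.d : ℝ))) *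
            (K * ((P.L : ℝ) ^ (j₁ + j₂ + j₃ - max j₁ (max j₂ j₃))) ^ P.d * Etop) := by
          refine mul_le_mul_of_nonneg_left (hconv.trans ?_) hℓ
          exact mul_le_mul_of_nonneg_left hexp_top (by positivity)
      _ = c₁ * c₂ * c₃ * K * Etop * (P.mesh j₁ ^ (a₁ - (P.d : ℝ)) * P.mesh j₂ ^ (a₂ - (P.d : ℝ)) *
            P.mesh j₃ ^ (a₃ - (P.d : ℝ)) * ((P.L : ℝ) ^ (j₁ + j₂ + j₃ - max j₁ (max j₂ j₃))) ^ P.d) := by ring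
      _ = _ := by rw [chain3_scale_algebra j₁ j₂ j₃ hmax a₁ a₂ a₃]; ring
  -- Step 3: sum over the scale triples
  have step3 := sum3_scales_le (P := P) (k := k) hL ha₁ ha₂ ha₃ hsum
  have hpre : 0 ≤ c₁ * c₂ * c₃ * K * ((P.mesh 0 ^ P.d)⁻¹) ^ 2 * Etop := by positivity
  calc ∑ u : HiggsLattice.Site P 0, ∑ v : HiggsLattice.Site P 0, F₁ u * F₂ u v * F₃ v
      ≤ _ := step1
    _ ≤ ∑ j₁ ∈ Finset.range k, ∑ j₂ ∈ Finset.range k, ∑ j₃ ∈ Finset.range k,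
          c₁ * c₂ * c₃ * K * ((P.mesh 0 ^ P.d)⁻¹) ^ 2 * Etop *
            (P.mesh j₁ ^ a₁ * P.mesh j₂ ^ a₂ * P.mesh j₃ ^ a₃ * (P.mesh (max j₁ (max j₂ j₃)) ^ P.d)⁻¹) :=
        Finset.sum_le_sum fun j₁ h₁ => Finset.sum_le_sum fun j₂ h₂ => Finset.sum_le_sum fun j₃ h₃ =>
          step2 j₁ j₂ j₃ (Finset.mem_range.1 h₁) (Finset.mem_range.1 h₂) (Finset.mem_range.1 h₃)
    _ = c₁ * c₂ * c₃ * K * ((P.mesh 0 ^ P.d)⁻¹) ^ 2 * Etop *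
          ∑ j₁ ∈ Finset.range k, ∑ j₂ ∈ Finset.range k, ∑ j₃ ∈ Finset.range k,
            P.mesh j₁ ^ a₁ * P.mesh j₂ ^ a₂ * P.mesh j₃ ^ a₃ * (P.mesh (max j₁ (max j₂ j₃)) ^ P.d)⁻¹ := by
        simp_rw [Finset.mul_sum]
    _ ≤ c₁ * c₂ * c₃ * K * ((P.mesh 0 ^ P.d)⁻¹) ^ 2 * Etop *
          ((1 / ((P.L : ℝ) ^ (a₁ * (1 - (P.d : ℝ) / (a₁ + a₂ + a₃))) - 1)) *
            (1 / ((P.L : ℝ) ^ (a₂ * (1 - (P.d : ℝ) / (a₁ + a₂ + a₃))) - 1)) *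
            (1 / ((P.L : ℝ) ^ (a₃ * (1 - (P.d : ℝ) / (a₁ + a₂ + a₃))) - 1)) *
            P.mesh k ^ (a₁ + a₂ + a₃ - (P.d : ℝ))) := mul_le_mul_of_nonneg_left step3 hpre
    _ = _ := by rw [hK, hEtop]; ring

/-- **The three-kernel chain over BONDS** (the shape in which the sources of `V_k(A,B)` produce it: both sums run over the bonds `b, b′`
of `T_ε`, the majorants are read at the base points `b₋, b′₋`): `d²` site chains, one for each pair of directions (`chain3_le`,
`HiggsCovariancePos.sum_site_dir`). [cite: Balaban1983Higgs3, (1.16) p.414, (2.6) p.424, (2.10) p.426] -/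
theorem bond_chain3_le (hL : 1 < P.L) {δ : ℝ} (hδ : 0 < δ) (hδ1 : δ ≤ 1) {a₁ a₂ a₃ : ℝ} (ha₁ : 0 < a₁) (ha₂ : 0 < a₂)
    (ha₃ : 0 < a₃) (hsum : (P.d : ℝ) < a₁ + a₂ + a₃) {c₁ c₂ c₃ : ℝ} (hc₁ : 0 ≤ c₁) (hc₂ : 0 ≤ c₂) (hc₃ : 0 ≤ c₃) (i₀ : Ix N)
    (x x' : HiggsLattice.Site P 0) (F₁ F₃ : HiggsLattice.PBond P 0 → ℝ) (F₂ : HiggsLattice.PBond P 0 → HiggsLattice.PBond P 0 → ℝ)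
    (hF₁0 : ∀ b, 0 ≤ F₁ b) (hF₂0 : ∀ b b', 0 ≤ F₂ b b') (hF₃0 : ∀ b', 0 ≤ F₃ b')
    (hF₁ : ∀ b, F₁ b ≤ ∑ j ∈ Finset.range k, c₁ * P.mesh j ^ (a₁ - (P.d : ℝ)) *
      Real.exp (-(δ * (P.mesh j)⁻¹ * (P.mesh 0 * (HiggsLattice.Site.tdist x b.src : ℝ)))))
    (hF₂ : ∀ b b', F₂ b b' ≤ ∑ j ∈ Finset.range k, c₂ * P.mesh j ^ (a₂ - (P.d : ℝ)) *
      Real.exp (-(δ * (P.mesh j)⁻¹ * (P.mesh 0 * (HiggsLattice.Site.tdist b.src b'.src : ℝ)))))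
    (hF₃ : ∀ b', F₃ b' ≤ ∑ j ∈ Finset.range k, c₃ * P.mesh j ^ (a₃ - (P.d : ℝ)) *
      Real.exp (-(δ * (P.mesh j)⁻¹ * (P.mesh 0 * (HiggsLattice.Site.tdist b'.src x' : ℝ))))) :
    ∑ b : HiggsLattice.PBond P 0, ∑ b' : HiggsLattice.PBond P 0, F₁ b * F₂ b b' * F₃ b'
      ≤ (P.d : ℝ) ^ 2 * (c₁ * c₂ * c₃ * (((nCol N : ℝ) * (8 * P.d / δ) ^ P.d) * ((nCol N : ℝ) * (16 * P.d / δ) ^ P.d)) *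
          ((1 / ((P.L : ℝ) ^ (a₁ * (1 - (P.d : ℝ) / (a₁ + a₂ + a₃))) - 1)) *
            (1 / ((P.L : ℝ) ^ (a₂ * (1 - (P.d : ℝ) / (a₁ + a₂ + a₃))) - 1)) *
            (1 / ((P.L : ℝ) ^ (a₃ * (1 - (P.d : ℝ) / (a₁ + a₂ + a₃))) - 1))) *
          ((P.mesh 0 ^ P.d)⁻¹) ^ 2 * P.mesh k ^ (a₁ + a₂ + a₃ - (P.d : ℝ)) *
          Real.exp (-(δ / 4 * (P.mesh k)⁻¹ * (P.mesh 0 * (HiggsLattice.Site.tdist x x' : ℝ))))) := by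
  -- bonds = sites × directions
  have hb : ∀ f : HiggsLattice.PBond P 0 → ℝ,
      ∑ b : HiggsLattice.PBond P 0, f b = ∑ μ : Fin P.d, ∑ u : HiggsLattice.Site P 0, f ⟨u, μ⟩ := by
    intro f
    rw [Finset.sum_comm, HiggsCovariancePos.sum_site_dir]
  rw [hb]
  simp_rw [hb (fun b' => F₁ _ * F₂ _ b' * F₃ b')]
  -- each pair of directions is a site chain
  have hdir : ∀ μ ν : Fin P.d,
      ∑ u : HiggsLattice.Site P 0, ∑ v : HiggsLattice.Site P 0, F₁ ⟨u, μ⟩ * F₂ ⟨u, μ⟩ ⟨v, ν⟩ * F₃ ⟨v, ν⟩ ≤ _ :=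
    fun μ ν => chain3_le (k := k) hL hδ hδ1 ha₁ ha₂ ha₃ hsum hc₁ hc₂ hc₃ i₀ x x' (fun u => F₁ ⟨u, μ⟩) (fun v => F₃ ⟨v, ν⟩)
      (fun u v => F₂ ⟨u, μ⟩ ⟨v, ν⟩) (fun u => hF₁0 _) (fun u v => hF₂0 _ _) (fun v => hF₃0 _)
      (fun u => hF₁ ⟨u, μ⟩) (fun u v => hF₂ ⟨u, μ⟩ ⟨v, ν⟩) (fun v => hF₃ ⟨v, ν⟩)
  calc ∑ μ : Fin P.d, ∑ u : HiggsLattice.Site P 0, ∑ ν : Fin P.d, ∑ v : HiggsLattice.Site P 0,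
          F₁ ⟨u, μ⟩ * F₂ ⟨u, μ⟩ ⟨v, ν⟩ * F₃ ⟨v, ν⟩
      = ∑ μ : Fin P.d, ∑ ν : Fin P.d, ∑ u : HiggsLattice.Site P 0, ∑ v : HiggsLattice.Site P 0,
          F₁ ⟨u, μ⟩ * F₂ ⟨u, μ⟩ ⟨v, ν⟩ * F₃ ⟨v, ν⟩ := Finset.sum_congr rfl fun μ _ => Finset.sum_comm
    _ ≤ ∑ μ : Fin P.d, ∑ ν : Fin P.d, _ := Finset.sum_le_sum fun μ _ => Finset.sum_le_sum fun ν _ => hdir μ ν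
    _ = _ := by simp only [Finset.sum_const, Finset.card_univ, Fintype.card_fin, nsmul_eq_mul]; ring

end Chain3

end Literature.MathematicalPhysics.QuantumFieldTheory.Balaban1983to89.B3Op116ScaleChains

end
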